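import Literature.AlgebraicGeometry.Motives.UniversalHyperplaneSectionSmoothNear
import Literature.AlgebraicGeometry.Motives.ProjectiveIncidence
import Literature.AlgebraicGeometry.Resolution.LinearSectionsCharts
import Literature.AlgebraicGeometry.Resolution.BlowupAlgebraRelations
import Literature.AlgebraicGeometry.Resolution.ProjectiveSpaceRegular
import Literature.AlgebraicGeometry.Motives.SubschemeCycles
import Literature.AlgebraicGeometry.Motives.AlgPointsSeparate
import Literature.AlgebraicGeometry.Motives.CurveNet
import Mathlib.RingTheory.LocalProperties.Reduced
import Mathlib.AlgebraicGeometry.FunctionField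
import HarnessLib

/-!
# The net of linear sections of `X ⊆ ℙᴺ`: total space, charts, local structure

Topic: `Literature/AlgebraicGeometry/Motives` (definitions + theorems, no named facts). For a field `k`,
a `k`-morphism `ι : X ⟶ ℙᴺ_k` (a closed immersion where stated) and `m + 1` linear forms with
coefficient vectors `a : Fin (m+1) → Fin (N+1) → k`, the **net of linear sections** of `X` is the diagram
`X ←σ— X̃ —π→ ℙᵐ` where `X̃ = {(x, b) ∈ X × ℙᵐ | aᵢ(x) b_{i'} = a_{i'}(x) bᵢ}` is the closure of the graph of
the linear projection `(a₀ : … : a_m) : X ⇢ ℙᵐ`; its fibre over `b ∈ ℙᵐ` is the linear section of `X` by the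
codimension-`m` linear subspace `{aᵢ b_{i'} = a_{i'} bᵢ} ⊇ Λ = V(a₀, …, a_m)`, and for a regular centre
`F = X ∩ Λ` it is the blowing up of `X` along `F` with `π` the morphism defined by the forms
(Hartshorne, *Algebraic Geometry*, II Example 7.17.3; the pencil/net of hyperplane sections of
Lefschetz theory, Voisin II §2.1.1). This file constructs it and proves its local structure; the
smoothness, irreducibility and fibre-connectedness conclusions for a smooth projective `X` and a
Bertini-general centre are drawn in `Motives/FiberNetExistenceProofs`
(`Motives.exists_fiberNet_smoothBase_nonempty`).

* `LinearSectionNet.incidenceForm a (i, i')` — the bihomogeneous forms `aᵢ(x) y_{i'} - a_{i'}(x) yᵢ` read in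
  the Segre coordinates `z_{(c,d)} = x_c y_d` of `ℙᴺ × ℙᵐ ↪ ℙ^{Nm+N+m}`; `locus ι a ⊆ X ×ₖ ℙᵐ` — the incidence
  locus, the preimage of `V₊(forms a)` under `X × ℙᵐ → ℙᴺ × ℙᵐ → ℙ^{Nm+N+m}` (it is the underlying set of the
  scheme-theoretic incidence correspondence of `Motives/ProjectiveIncidence`, `coe_locus_eq_range`);
* `total ι a = X̃` — the incidence locus with its REDUCED induced structure (as for the universal
  hyperplane section, `Motives/UniversalHyperplaneSection`; Hartshorne II Example 3.2.6), with
  `emb : X̃ ↪ X ×ₖ ℙᵐ`, `blowDown = σ = pr₁`, `proj = π = pr₂`; `X̃` is reduced, projective over `k` when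
  `X` is, `σ`, `π` are proper when `X` is;
* charts: for an affine open `X' ⊆ ι⁻¹D₊(x_j)` and the chart `D₊(y_l) ⊆ ℙᵐ`, the open immersion
  `chartImm X l X' : Spec (Γ(X, X') ⊗ₖ (k[y]_{(y_l)})₀) = X' ×ₖ D₊(y_l) ↪ X ×ₖ ℙᵐ` of
  `Motives/UniversalHyperplaneSectionChart` is compared with the Segre map (`chartImm_toSegre`, two
  projective spaces of different dimensions), the forms become the functions
  `incFun = aᵢ/x_j ⊗ y_{i'}/y_l - a_{i'}/x_j ⊗ yᵢ/y_l` with `uForm ι j hX' v = v(x)/x_j ∈ Γ(X, X')`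
  (`map_linSec`: the sections `Resolution.LinSec.linSec` of `LinearSectionsCharts` restricted to `X'`),
  and **in the chart the incidence locus is their common zero locus** (`preimage_chartImm_locus`); the piece
  `chartSection = X̃ ∩ (X' × D₊(y_l))` is the unique reduced closed subscheme of the chart with this support
  (`exists_iso_chartSection`);
* **local model** (`modelImm`, `exists_modelIso`): in polynomial coordinates
  `Γ(X, X') ⊗ₖ (k[y]_{(y_l)})₀ ≃ Γ(X, X')[T_i : i ≠ l]` (`polyEquiv`) the ideal of the `incFun` is the ideal of
  the obvious relations `aᵢ/x_j - (a_l/x_j) Tᵢ` of the AFFINE BLOWUP ALGEBRA `Γ(X, X')[I/(a_l/x_j)]`,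
  `I = (a₀/x_j, …, a_m/x_j)` (tree `Resolution.blowupAlgebra`, `blowupAlgebra.eval`); when the centre
  `(a₀/x_j, …, a_m/x_j)` is a quasi-regular sequence in `Γ(X, X')` the relations cut out the blowup algebra
  set-theoretically (`Resolution/BlowupAlgebraRelations`), so for `X` reduced
  **`X̃ ∩ (X' × D₊(y_l)) ≅ Spec Γ(X, X')[I/(a_l/x_j)]`**, the chart `D₊(a_l)` of the blowing up of `X'`
  along `I` (Hartshorne II Example 7.17.3: `X̃ = Bl_F X`);
* consequences: over `X_{h,l} = {a_l ≠ 0} ∩ ι⁻¹D₊(x_h)` the centre is the unit ideal and the model is `X'`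
  itself, whence **`σ` is an isomorphism over `X ∖ F`** (`isIso_blowDown_restrict_offBase`, `F = baseLocus`
  the common zero set `Resolution.LinSec.cutSet` of the forms); under the hypothesis `GoodCentre` (every
  point of `F` has a chart on which the centre is quasi-regular with regular quotient ring — Bertini) and for
  `X` regular, resp. integral, **`X̃` is regular** (`isRegular_total`: Liu Thm. 8.1.19 (a) on the charts,
  tree `blowupAlgebra.isRegularRing`), resp. **irreducible** (`irreducibleSpace_total`);
* `sectionAt ι a β hβ : ℙᵐ → X̃`, `b ↦ (β, b)` — **the section of `π` through a rational point `β` of the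
  base locus** (`sectionAt_proj`), which makes `π` geometrically connected by the Stein argument of
  `Motives/FiberNetExistence` (`SectionStein.geometricallyConnected`) once `X̃` is integral.

## References

* [Hartshorne1977] R. Hartshorne, Algebraic Geometry (1977), II Example 3.2.6, II Example 7.17.3,
  II Thm. 8.18, II Thm. 8.24, II Ex. 5.11.
* [VoisinHodgeII2003] C. Voisin, Hodge Theory and Complex Algebraic Geometry II, CUP 2003, §2.1.1.
* [Liu2002] Q. Liu, Algebraic Geometry and Arithmetic Curves, OUP 2002, Thm. 8.1.19 (a).
* [StacksProject] The Stacks Project, Tags 052P, 0BIQ, 03H2.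
-/

noncomputable section

open CategoryTheory AlgebraicGeometry Limits MonoidalCategory CartesianMonoidalCategory
  HomogeneousLocalization TensorProduct MvPolynomial

universe u

namespace Literature.AlgebraicGeometry.Motives

attribute [local instance] MvPolynomial.gradedAlgebra

namespace LinearSectionNet

open UniversalHyperplaneSection

section Forms

open ProjectiveSpace Literature.AlgebraicGeometry.Resolution

variable {k : Type u} [Field k] {N m : ℕ}

/-! ### The incidence forms `aᵢ(x) yⱼ - aⱼ(x) yᵢ` -/

/-- The value `Σ_c v_c z_c ∈ L` of the linear form with coefficients `v` at the vector `z`. [folklore] -/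
def linEval {L : Type*} [CommRing L] [Algebra k L] (v : Fin (N + 1) → k) (z : Fin (N + 1) → L) : L :=
  ∑ c, algebraMap k L (v c) * z c

/-- `aeval z (Σ v_c x_c) = linEval v z`. [folklore] -/
theorem aeval_linForm {L : Type*} [CommRing L] [Algebra k L] (v : Fin (N + 1) → k)
    (z : Fin (N + 1) → L) : aeval z (LinSec.linForm v) = linEval v z := by
  simp [LinSec.linForm, linEval, map_sum, Algebra.algebraMap_eq_smul_one]

variable (a : Fin (m + 1) → Fin (N + 1) → k)

/-- The bilinear form `aᵢ(x) · yⱼ = Σ_c a_{ic} z_{(c,j)}` in the Segre coordinates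
`z_{(c,d)} = x_c y_d` of `ℙᴺ × ℙᵐ ↪ ℙ^{Nm+N+m}`. [cite: Hartshorne1977, II Example 7.17.3] -/
def mulForm (i j : Fin (m + 1)) : MvPolynomial (Fin (N * m + N + m + 1)) k :=
  ∑ c : Fin (N + 1), C (a i c) * X (segreIndexEquiv N m (c, j))

/-- The incidence form `aᵢ(x) yⱼ - aⱼ(x) yᵢ` (the equations `{aᵢ yⱼ = aⱼ yᵢ}` of the blow-up /
incidence variety). [cite: Hartshorne1977, II Example 7.17.3] -/
def incidenceForm (p : Fin (m + 1) × Fin (m + 1)) : MvPolynomial (Fin (N * m + N + m + 1)) k :=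
  mulForm a p.1 p.2 - mulForm a p.2 p.1

/-- The set of all incidence forms. [folklore] -/
def forms : Set (MvPolynomial (Fin (N * m + N + m + 1)) k) := Set.range (incidenceForm a)

/-- The forms `aᵢ(x) y_j` are linear in the Segre variables. [folklore] -/
theorem isHomogeneous_mulForm (i j : Fin (m + 1)) : (mulForm a i j).IsHomogeneous 1 := by
  refine MvPolynomial.IsHomogeneous.sum _ _ _ fun c _ => ?_
  simpa using (isHomogeneous_C _ (a i c)).mul (isHomogeneous_X k (segreIndexEquiv N m (c, j)))

/-- The incidence forms are linear in the Segre variables. [folklore] -/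
theorem isHomogeneous_incidenceForm (p : Fin (m + 1) × Fin (m + 1)) :
    (incidenceForm a p).IsHomogeneous 1 :=
  (isHomogeneous_mulForm a p.1 p.2).sub (isHomogeneous_mulForm a p.2 p.1)

/-- Every incidence form is homogeneous of positive degree. [folklore] -/
theorem forms_isHomogeneous : ∀ g ∈ forms a, ∃ d, 0 < d ∧ g.IsHomogeneous d := by
  rintro _ ⟨p, rfl⟩
  exact ⟨1, one_pos, isHomogeneous_incidenceForm a p⟩

/-- Evaluation of `aᵢ(x) yⱼ` at `z ⊗ w`. [folklore] -/
theorem aeval_segreVec_mulForm {L : Type u} [Field L] [Algebra k L] (z : Fin (N + 1) → L)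
    (w : Fin (m + 1) → L) (i j : Fin (m + 1)) :
    aeval (segreVec z w) (mulForm a i j) = linEval (a i) z * w j := by
  simp [mulForm, linEval, map_sum, Finset.sum_mul, Algebra.algebraMap_eq_smul_one]

/-- Evaluation of the incidence form at `z ⊗ w`. [folklore] -/
theorem aeval_segreVec_incidenceForm {L : Type u} [Field L] [Algebra k L] (z : Fin (N + 1) → L)
    (w : Fin (m + 1) → L) (p : Fin (m + 1) × Fin (m + 1)) :
    aeval (segreVec z w) (incidenceForm a p) =
      linEval (a p.1) z * w p.2 - linEval (a p.2) z * w p.1 := by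
  simp [incidenceForm, aeval_segreVec_mulForm]

end Forms

variable {k : Type u} [Field k] {N m : ℕ} {X : SchemeOver k} (ι : X ⟶ projectiveSpace N k)

/-- Notation-free abbreviation: the grading of `k[x₀, …, x_N]`. -/
local notation "𝒜" => Segre.grading (Fin (N + 1)) k

attribute [local instance] chartBaseRingAlgebra sectionsAlgebra

section Incidence

variable (j : Fin (N + 1)) (l : Fin (m + 1)) (X' : X.left.affineOpens)

/-- The chart `X' ×ₖ D₊(y_l)` of `X ×ₖ ℙᵐ` mapped to the standard chart `D₊(x_j) ⊆ ℙᴺ` of the FIRST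
factor: `Spec (Γ(X, X') ⊗ R) → Spec Γ(X, X') → Spec (k[x]_{(x_j)})₀` (for `X' ⊆ ι⁻¹D₊(x_j)`).
This and the next four lemmas generalise `UniversalHyperplaneSection.chartα`,
`UniversalHyperplaneSection.specMap_fromSpec_ι`, `…chartα_chartι_toSpec`, `…chartImm_toSegre` of
`Motives/UniversalHyperplaneSectionChart`, which are hard-wired to a second factor `ℙᴺ` of the SAME
dimension (`l : Fin (N + 1)`); here the second factor is `ℙᵐ`. [folklore] -/
def chartα (hX' : (X' : X.left.Opens) ≤ ι.left ⁻¹ᵁ Proj.basicOpen 𝒜 (MvPolynomial.X j)) :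
    Spec (.of (chartRing (X := X) l X')) ⟶ Spec (.of (Away 𝒜 (MvPolynomial.X j))) :=
  Spec.map (CommRingCat.ofHom (algebraMap Γ(X.left, (X' : X.left.Opens)) (chartRing l X'))) ≫
    Spec.map (ι.left.appLE (Proj.basicOpen 𝒜 (MvPolynomial.X j)) X' hX') ≫
      Spec.map (Proj.awayToSection 𝒜 (MvPolynomial.X j))

/-- The function `x_i/x_j` pulled back along `chartα` is `uᵢ ⊗ 1`. [folklore] -/
theorem pull_chartα_frac (hX' : (X' : X.left.Opens) ≤ ι.left ⁻¹ᵁ Proj.basicOpen 𝒜 (MvPolynomial.X j))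
    (i : Fin (N + 1)) :
    Segre.pull (chartα ι j l X' hX') (Segre.frac k j i) =
      (Scheme.ΓSpecIso (.of (chartRing l X'))).inv (secCoord ι j X' hX' i ⊗ₜ[k] (1 : chartBaseRing m l)) := by
  rw [chartα, ← Category.assoc, Segre.pull_SpecMap, Segre.pull_SpecMap, ← Category.id_comp (Spec.map _),
    Segre.pull_SpecMap, Segre.pull_apply, Scheme.Hom.id_appTop]
  rfl

/-- `Spec (Γ(X, X') ⊗ R) → Spec Γ(X, X') = X' ⊆ X → ℙᴺ` factors through the chart `D₊(x_j)`:
it is `chartα ≫ (D₊(x_j) ↪ ℙᴺ)` (same statement and proof as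
`UniversalHyperplaneSection.specMap_fromSpec_ι`, for the present two-dimension-parameter `chartα`).
[folklore] -/
theorem specMap_fromSpec_ι (hX' : (X' : X.left.Opens) ≤ ι.left ⁻¹ᵁ Proj.basicOpen 𝒜 (MvPolynomial.X j)) :
    Spec.map (CommRingCat.ofHom (algebraMap Γ(X.left, (X' : X.left.Opens)) (chartRing l X'))) ≫
        X'.2.fromSpec ≫ ι.left = chartα ι j l X' hX' ≫ Segre.chartι k j := by
  have h1 := IsAffineOpen.SpecMap_appLE_fromSpec ι.left
    (ProjSubscheme.affineBasicOpen 𝒜 (MvPolynomial.X j) (Segre.X_mem k j) zero_lt_one).2 X'.2 hX'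
  have h2 := ProjSubscheme.fromSpec_affineBasicOpen 𝒜 (MvPolynomial.X j) (Segre.X_mem k j) zero_lt_one
  have h4 : chartα ι j l X' hX' ≫ Segre.chartι k j =
      Spec.map (CommRingCat.ofHom (algebraMap Γ(X.left, (X' : X.left.Opens)) (chartRing l X'))) ≫
        Spec.map (ι.left.appLE (Proj.basicOpen 𝒜 (MvPolynomial.X j)) X' hX') ≫
          (ProjSubscheme.affineBasicOpen 𝒜 (MvPolynomial.X j) (Segre.X_mem k j) zero_lt_one).2.fromSpec := by
    rw [h2, chartα, Category.assoc, Category.assoc]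
    rfl
  have h5 := congrArg (Spec.map (CommRingCat.ofHom
    (algebraMap Γ(X.left, (X' : X.left.Opens)) (chartRing l X'))) ≫ ·) h1
  exact (h4.trans h5).symm

/-- The two chart maps are compatible over `Spec k`. [folklore] -/
theorem chartα_chartι_toSpec (hX' : (X' : X.left.Opens) ≤ ι.left ⁻¹ᵁ Proj.basicOpen 𝒜 (MvPolynomial.X j)) :
    chartα ι j l X' hX' ≫ Segre.chartι k j ≫ Segre.toSpec (Fin (N + 1)) k =
      chartβ l X' ≫ Segre.chartι k l ≫ Segre.toSpec (Fin (m + 1)) k := by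
  have e1 := specMap_fromSpec_ι ι j l X' hX'
  calc chartα ι j l X' hX' ≫ Segre.chartι k j ≫ Segre.toSpec (Fin (N + 1)) k
      = (chartα ι j l X' hX' ≫ Segre.chartι k j) ≫ Segre.toSpec (Fin (N + 1)) k :=
        (Category.assoc _ _ _).symm
    _ = (Spec.map (CommRingCat.ofHom (algebraMap Γ(X.left, (X' : X.left.Opens)) (chartRing l X'))) ≫
          X'.2.fromSpec ≫ ι.left) ≫ (projectiveSpace N k).hom := by rw [← e1]; rfl
    _ = Spec.map (CommRingCat.ofHom (algebraMap Γ(X.left, (X' : X.left.Opens)) (chartRing l X'))) ≫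
          X'.2.fromSpec ≫ X.hom := by simp only [Category.assoc, Over.w ι]
    _ = (chartImm X l X' ≫ pullback.fst X.hom (projectiveSpace m k).hom) ≫ X.hom := by
          rw [chartImm_fst, Category.assoc]
    _ = chartImm X l X' ≫ pullback.snd X.hom (projectiveSpace m k).hom ≫
          (projectiveSpace m k).hom := by rw [Category.assoc, pullback.condition]
    _ = (chartβ l X' ≫ chartBaseι m l) ≫ (projectiveSpace m k).hom := by
          rw [← chartImm_snd, Category.assoc]
    _ = chartβ l X' ≫ Segre.chartι k l ≫ Segre.toSpec (Fin (m + 1)) k := by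
          rw [Category.assoc]; rfl

/-- The chart followed by `toSegre : X ×ₖ ℙᵐ ⟶ ℙᴺ ×ₖ ℙᵐ ⟶ ℙ^{Nm+N+m}` is the chart-level Segre map
of the pair (`chartα`, `chartβ`). [cite: Hartshorne1977, II Ex. 5.11] -/
theorem chartImm_toSegre (hX' : (X' : X.left.Opens) ≤ ι.left ⁻¹ᵁ Proj.basicOpen 𝒜 (MvPolynomial.X j)) :
    chartImm X l X' ≫ (Incidence.toSegre ι (𝟙 (projectiveSpace m k))).left =
      Segre.segreMap (segreIndexEquiv N m) j l (chartα ι j l X' hX') (chartβ l X') := by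
  have hαβ := chartα_chartι_toSpec ι j l X' hX'
  have hν : (chartImm X l X' ≫ (ι ⊗ₘ 𝟙 (projectiveSpace m k)).left :
      Spec (.of (chartRing l X')) ⟶ pullback (Segre.toSpec (Fin (N + 1)) k) (Segre.toSpec (Fin (m + 1)) k)) =
      pullback.lift (f := Segre.toSpec (Fin (N + 1)) k) (g := Segre.toSpec (Fin (m + 1)) k)
        (chartα ι j l X' hX' ≫ Segre.chartι k j) (chartβ l X' ≫ Segre.chartι k l) hαβ := by
    apply pullback.hom_ext
    · have e1 : ((ι ⊗ₘ 𝟙 (projectiveSpace m k)).left ≫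
          pullback.fst (projectiveSpace N k).hom (projectiveSpace m k).hom :
            pullback X.hom (projectiveSpace m k).hom ⟶ Proj 𝒜) =
          pullback.fst X.hom (projectiveSpace m k).hom ≫ ι.left := by
        rw [Over.tensorHom_left]
        exact pullback.lift_fst _ _ _
      have e2 : (chartImm X l X' ≫ pullback.fst X.hom (projectiveSpace m k).hom ≫ ι.left :
          Spec (.of (chartRing l X')) ⟶ Proj 𝒜) = chartα ι j l X' hX' ≫ Segre.chartι k j := by
        rw [← specMap_fromSpec_ι ι j l X' hX', ← chartImm_fst_assoc]
        rfl
      calc ((chartImm X l X' ≫ (ι ⊗ₘ 𝟙 (projectiveSpace m k)).left) ≫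
            pullback.fst (Segre.toSpec (Fin (N + 1)) k) (Segre.toSpec (Fin (m + 1)) k) :
              Spec (.of (chartRing l X')) ⟶ Proj 𝒜)
          = (chartImm X l X' ≫ (ι ⊗ₘ 𝟙 (projectiveSpace m k)).left ≫
              pullback.fst (projectiveSpace N k).hom (projectiveSpace m k).hom :
                Spec (.of (chartRing l X')) ⟶ Proj 𝒜) := Category.assoc _ _ _
        _ = (chartImm X l X' ≫ pullback.fst X.hom (projectiveSpace m k).hom ≫ ι.left :
                Spec (.of (chartRing l X')) ⟶ Proj 𝒜) :=
              congrArg (chartImm X l X' ≫ ·) e1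
        _ = chartα ι j l X' hX' ≫ Segre.chartι k j := e2
        _ = _ := (pullback.lift_fst _ _ _).symm
    · have e1 : ((ι ⊗ₘ 𝟙 (projectiveSpace m k)).left ≫
          pullback.snd (projectiveSpace N k).hom (projectiveSpace m k).hom :
            pullback X.hom (projectiveSpace m k).hom ⟶ (projectiveSpace m k).left) =
          pullback.snd X.hom (projectiveSpace m k).hom := by
        rw [Over.tensorHom_left]
        exact (pullback.lift_snd _ _ _).trans (Category.comp_id _)
      calc ((chartImm X l X' ≫ (ι ⊗ₘ 𝟙 (projectiveSpace m k)).left) ≫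
            pullback.snd (Segre.toSpec (Fin (N + 1)) k) (Segre.toSpec (Fin (m + 1)) k) :
              Spec (.of (chartRing l X')) ⟶ (projectiveSpace m k).left)
          = (chartImm X l X' ≫ (ι ⊗ₘ 𝟙 (projectiveSpace m k)).left ≫
              pullback.snd (projectiveSpace N k).hom (projectiveSpace m k).hom :
                Spec (.of (chartRing l X')) ⟶ (projectiveSpace m k).left) := Category.assoc _ _ _
        _ = (chartImm X l X' ≫ pullback.snd X.hom (projectiveSpace m k).hom :
                Spec (.of (chartRing l X')) ⟶ (projectiveSpace m k).left) :=
              congrArg (chartImm X l X' ≫ ·) e1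
        _ = chartβ l X' ≫ chartBaseι m l := chartImm_snd l X'
        _ = _ := (pullback.lift_snd _ _ _).symm
  have hfac : pullback.lift (chartα ι j l X' hX') (chartβ l X') hαβ ≫
        (Segre.prodCover (Fin (N + 1)) (Fin (m + 1)) k).f (j, l) =
      pullback.lift (f := Segre.toSpec (Fin (N + 1)) k) (g := Segre.toSpec (Fin (m + 1)) k)
        (chartα ι j l X' hX' ≫ Segre.chartι k j) (chartβ l X' ≫ Segre.chartι k l) hαβ := by
    apply pullback.hom_ext
    · rw [Category.assoc, Segre.prodCover_f_fst, Segre.chartFst, pullback.lift_fst_assoc,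
        pullback.lift_fst]
    · rw [Category.assoc, Segre.prodCover_f_snd, Segre.chartSnd, pullback.lift_snd_assoc,
        pullback.lift_snd]
  have hfin : (pullback.lift (chartα ι j l X' hX') (chartβ l X') hαβ ≫
      (Segre.prodCover (Fin (N + 1)) (Fin (m + 1)) k).f (j, l)) ≫ Segre.segre k (segreIndexEquiv N m) =
      Segre.segreMap (segreIndexEquiv N m) j l (chartα ι j l X' hX') (chartβ l X') := by
    rw [Category.assoc, Segre.prodCover_f_segre, Segre.segreChart, Segre.comp_segreMap, Segre.chartFst,
      Segre.chartSnd, pullback.lift_fst, pullback.lift_snd]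
  rw [← hfin, hfac, ← hν, Category.assoc]
  rfl

/-! ### The linear forms on the chart and the incidence functions -/

variable {X' l} in
/-- Any degree-zero fraction pulled back along `chartα` is `coordRingHom` of it, tensor `1`. [folklore] -/
theorem pull_chartα (hX' : (X' : X.left.Opens) ≤ ι.left ⁻¹ᵁ Proj.basicOpen 𝒜 (MvPolynomial.X j))
    (z : Away 𝒜 (MvPolynomial.X j)) :
    Segre.pull (chartα ι j l X' hX') z =
      (Scheme.ΓSpecIso (.of (chartRing l X'))).inv (coordRingHom ι j X' hX' z ⊗ₜ[k] (1 : chartBaseRing m l)) := by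
  rw [chartα, ← Category.assoc, Segre.pull_SpecMap, Segre.pull_SpecMap, ← Category.id_comp (Spec.map _),
    Segre.pull_SpecMap, Segre.pull_apply, Scheme.Hom.id_appTop]
  rfl

variable {l X'} in
/-- The degree-zero fraction `(Σ_c v_c x_c)/x_j ∈ (k[x]_{(x_j)})₀` of a linear form, written as the
combination `Σ_c v_c · (x_c/x_j)` of the affine coordinates. [folklore] -/
def linFrac (v : Fin (N + 1) → k) : Away 𝒜 (MvPolynomial.X j) :=
  ∑ c, Segre.cst k (MvPolynomial.X j) (v c) * Segre.frac k j c

variable {l X'} in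
/-- `Σ_c v_c · (x_c/x_j) = (Σ_c v_c x_c)/x_j` (the tree's `Away.isLocalizationElem` of the linear
form, as used by `Resolution.LinSec.linSec`). [folklore] -/
theorem linFrac_eq (v : Fin (N + 1) → k) :
    linFrac (k := k) j v = Away.isLocalizationElem (Segre.X_mem k j)
      (Literature.AlgebraicGeometry.Resolution.LinSec.linForm_mem v) := by
  apply HomogeneousLocalization.val_injective
  rw [linFrac, ← HomogeneousLocalization.algebraMap_apply, map_sum, Away.isLocalizationElem,
    HomogeneousLocalization.Away.val_mk, pow_one, Literature.AlgebraicGeometry.Resolution.LinSec.linForm,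
    Localization.mk_eq_mk', IsLocalization.mk'_eq_mul_mk'_one, map_sum, Finset.sum_mul]
  refine Finset.sum_congr rfl fun c _ => ?_
  rw [map_mul, HomogeneousLocalization.algebraMap_apply, HomogeneousLocalization.algebraMap_apply,
    Segre.val_cst, Segre.val_frac, Localization.mk_eq_mk', IsLocalization.mk'_eq_mul_mk'_one, map_mul,
    mul_assoc, pow_one]

variable {X'} in
/-- The regular function `a(x)/x_j = Σ_c a_c · ι^*(x_c/x_j)|_{X'} ∈ Γ(X, X')` of a linear form with
coefficient vector `v`. [folklore] -/
def uForm (hX' : (X' : X.left.Opens) ≤ ι.left ⁻¹ᵁ Proj.basicOpen 𝒜 (MvPolynomial.X j))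
    (v : Fin (N + 1) → k) : Γ(X.left, (X' : X.left.Opens)) :=
  coordRingHom ι j X' hX' (linFrac j v)

variable {l X'} in
/-- **Dictionary with `Resolution.LinSec`**: restricted to `X' ⊆ ι⁻¹D₊(x_j)`, the section
`(Σ_c v_c x_c)/x_j` of `LinearSectionsCharts` is `uForm`. [folklore] -/
theorem map_linSec (hX' : (X' : X.left.Opens) ≤ ι.left ⁻¹ᵁ Proj.basicOpen 𝒜 (MvPolynomial.X j))
    (v : Fin (N + 1) → k) :
    X.left.presheaf.map (homOfLE hX').op
        (Literature.AlgebraicGeometry.Resolution.LinSec.linSec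
          (ι.left : X.left ⟶ Literature.AlgebraicGeometry.Morphisms.ProjCech.PP k N) j v) =
      uForm ι j hX' v := by
  rw [uForm, linFrac_eq, Literature.AlgebraicGeometry.Resolution.LinSec.linSec, ProjFrac.evalAway_apply,
    coordRingHom]
  rfl

variable (a : Fin (m + 1) → Fin (N + 1) → k)

variable {j X'} in
/-- The incidence function `aᵢ(x)/x_j ⊗ y_{i'}/y_l - a_{i'}(x)/x_j ⊗ yᵢ/y_l` on the chart: the
bihomogeneous form `aᵢ(x) y_{i'} - a_{i'}(x) yᵢ` divided by `x_j y_l`. [folklore] -/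
def incFun (hX' : (X' : X.left.Opens) ≤ ι.left ⁻¹ᵁ Proj.basicOpen 𝒜 (MvPolynomial.X j))
    (p : Fin (m + 1) × Fin (m + 1)) : chartRing (X := X) l X' :=
  uForm ι j hX' (a p.1) ⊗ₜ[k] Segre.frac k l p.2 - uForm ι j hX' (a p.2) ⊗ₜ[k] Segre.frac k l p.1

/-- The Segre chart ring map sends `Σ_c a_c z_{(c,d)}` to `a(x)/x_j ⊗ y_d/y_l`. [folklore] -/
theorem segreFun_mulForm (hX' : (X' : X.left.Opens) ≤ ι.left ⁻¹ᵁ Proj.basicOpen 𝒜 (MvPolynomial.X j))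
    (v : Fin (N + 1) → k) (d : Fin (m + 1)) :
    Segre.segreFun (segreIndexEquiv N m) j l (chartα ι j l X' hX') (chartβ l X')
        (∑ c : Fin (N + 1), MvPolynomial.C (v c) * MvPolynomial.X (segreIndexEquiv N m (c, d))) =
      (Scheme.ΓSpecIso (.of (chartRing l X'))).inv (uForm ι j hX' v ⊗ₜ[k] Segre.frac k l d) := by
  have h1 : ∀ c : Fin (N + 1), Segre.segreFun (segreIndexEquiv N m) j l (chartα ι j l X' hX') (chartβ l X')
      (MvPolynomial.C (v c) * MvPolynomial.X (segreIndexEquiv N m (c, d))) =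
      Segre.pull (chartα ι j l X' hX') (Segre.cst k (MvPolynomial.X j) (v c) * Segre.frac k j c) *
        Segre.pull (chartβ l X') (Segre.frac k l d) := fun c => by
    rw [map_mul, Segre.segreFun_C, Segre.segreFun_X_apply, map_mul, mul_assoc]
  rw [map_sum, Finset.sum_congr rfl fun c _ => h1 c, ← Finset.sum_mul, ← map_sum, ← linFrac, pull_chartα,
    pull_chartβ_frac, ← map_mul, Algebra.TensorProduct.tmul_mul_tmul, one_mul, mul_one]
  rfl

/-- **The incidence equation on the chart**: the Segre chart ring map sends the incidence form
`(aᵢ(x) y_{i'} - a_{i'}(x) yᵢ)/(x_j y_l)` to `incFun`. [folklore] -/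
theorem segreRingHom_incidenceForm
    (hX' : (X' : X.left.Opens) ≤ ι.left ⁻¹ᵁ Proj.basicOpen 𝒜 (MvPolynomial.X j))
    (p : Fin (m + 1) × Fin (m + 1)) :
    Segre.segreRingHom (segreIndexEquiv N m) j l (chartα ι j l X' hX') (chartβ l X')
        (Away.isLocalizationElem (Segre.X_mem k (segreIndexEquiv N m (j, l)))
          (isHomogeneous_incidenceForm a p)) =
      (Scheme.ΓSpecIso (.of (chartRing l X'))).inv (incFun ι l a hX' p) := by
  rw [Away.isLocalizationElem, Segre.segreRingHom_awayMk, pow_one, incidenceForm,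
    map_sub, mulForm, mulForm, segreFun_mulForm, segreFun_mulForm,
    incFun, map_sub]

/-- **One bihomogeneous equation in the coordinates of the chart**: for a form `g` of degree `1`
on `ℙ^{Nm+N+m}` whose image under the Segre chart ring map is the function `G`, the preimage under
the chart `X' ×ₖ D₊(y_l) ↪ X ×ₖ ℙᵐ` of `toSegre⁻¹ V₊(g)` is the zero locus of `G`.
[cite: Hartshorne1977, II Ex. 5.11] -/
theorem preimage_chartImm_preimage_zeroLocus
    (hX' : (X' : X.left.Opens) ≤ ι.left ⁻¹ᵁ Proj.basicOpen 𝒜 (MvPolynomial.X j))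
    {g : MvPolynomial (Fin (N * m + N + m + 1)) k} (hg : g.IsHomogeneous 1) (G : chartRing (X := X) l X')
    (hG : Segre.segreRingHom (segreIndexEquiv N m) j l (chartα ι j l X' hX') (chartβ l X')
        (Away.isLocalizationElem (Segre.X_mem k (segreIndexEquiv N m (j, l))) hg) =
      (Scheme.ΓSpecIso (.of (chartRing l X'))).inv G) :
    chartImm X l X' ⁻¹' ((Incidence.toSegre ι (𝟙 (projectiveSpace m k))).left ⁻¹'
        ProjectiveSpectrum.zeroLocus (Segre.grading (Fin (N * m + N + m + 1)) k) {g}) =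
      PrimeSpectrum.zeroLocus {G} := by
  ext x
  have hfun : (Incidence.toSegre ι (𝟙 (projectiveSpace m k))).left (chartImm X l X' x) =
      Segre.segreMap (segreIndexEquiv N m) j l (chartα ι j l X' hX') (chartβ l X') x :=
    congrArg (fun φ : Spec (.of (chartRing l X')) ⟶ (projectiveSpace (N * m + N + m) k).left ↦ φ x)
      (chartImm_toSegre ι j l X' hX')
  set ρ := Segre.segreRingHom (segreIndexEquiv N m) j l (chartα ι j l X' hX') (chartβ l X') with hρ
  set z := (Spec (CommRingCat.of (chartRing l X'))).toSpecΓ x with hz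
  set q := Away.isLocalizationElem (Segre.X_mem k (segreIndexEquiv N m (j, l))) hg with hq
  have step1 : x ∈ chartImm X l X' ⁻¹' ((Incidence.toSegre ι (𝟙 (projectiveSpace m k))).left ⁻¹'
        ProjectiveSpectrum.zeroLocus (Segre.grading (Fin (N * m + N + m + 1)) k) {g}) ↔
      Spec.map (CommRingCat.ofHom ρ) z ∈
        Proj.awayι (Segre.grading (Fin (N * m + N + m + 1)) k)
            (MvPolynomial.X (segreIndexEquiv N m (j, l))) (Segre.X_mem k (segreIndexEquiv N m (j, l)))
            zero_lt_one ⁻¹'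
          ProjectiveSpectrum.zeroLocus (Segre.grading (Fin (N * m + N + m + 1)) k) {g} := by
    change (Incidence.toSegre ι (𝟙 (projectiveSpace m k))).left (chartImm X l X' x) ∈
      ProjectiveSpectrum.zeroLocus (Segre.grading (Fin (N * m + N + m + 1)) k) {g} ↔ _
    rw [hfun]
    rfl
  have step2 := Set.ext_iff.mp (ProjSubscheme.awayι_preimage_zeroLocus
    (Segre.grading (Fin (N * m + N + m + 1)) k) (Segre.X_mem k (segreIndexEquiv N m (j, l))) zero_lt_one
    hg zero_lt_one) (Spec.map (CommRingCat.ofHom ρ) z)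
  have step3 : Spec.map (CommRingCat.ofHom ρ) z ∈ PrimeSpectrum.zeroLocus {q} ↔
      z ∈ PrimeSpectrum.zeroLocus {ρ q} := by
    refine (PrimeSpectrum.mem_zeroLocus _ _).trans (Set.singleton_subset_iff.trans ?_)
    refine Iff.trans ?_ ((PrimeSpectrum.mem_zeroLocus _ _).trans Set.singleton_subset_iff).symm
    exact Iff.rfl
  have step4 : z ∈ PrimeSpectrum.zeroLocus {ρ q} ↔ x ∈ PrimeSpectrum.zeroLocus {G} := by
    have h := Set.ext_iff.mp ((Spec (CommRingCat.of (chartRing l X'))).toSpecΓ_preimage_zeroLocus {ρ q}) x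
    refine h.trans ((Scheme.mem_zeroLocus_iff _ _ _).trans ?_)
    refine Iff.trans ?_ ((PrimeSpectrum.mem_zeroLocus _ _).trans Set.singleton_subset_iff).symm
    simp only [Set.mem_singleton_iff, forall_eq]
    rw [hG, basicOpen_eq_of_affine]
    exact not_not
  exact step1.trans (step2.trans (step3.trans step4))

end Incidence

/-! ### The incidence locus and the total space `X̃` -/

section Total

variable (a : Fin (m + 1) → Fin (N + 1) → k)

/-- **The incidence locus** `{(x, b) ∈ X × ℙᵐ | aᵢ(x) b_{i'} = a_{i'}(x) bᵢ ∀ i, i'}` as a closed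
subset of `X ×ₖ ℙᵐ`: the preimage of `V₊(aᵢ(x) y_{i'} - a_{i'}(x) yᵢ) ⊆ ℙ^{Nm+N+m}` under
`X × ℙᵐ → ℙᴺ × ℙᵐ → ℙ^{Nm+N+m}` (the closure of the graph of the linear projection
`(a₀ : … : a_m) : X ⇢ ℙᵐ` for a regular centre). [cite: Hartshorne1977, II Example 7.17.3] -/
def locus : TopologicalSpace.Closeds (X ⊗ projectiveSpace m k).left :=
  ⟨(Incidence.toSegre ι (𝟙 (projectiveSpace m k))).left ⁻¹'
      ProjectiveSpectrum.zeroLocus (Segre.grading (Fin (N * m + N + m + 1)) k) (forms a),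
    (ProjectiveSpectrum.isClosed_zeroLocus _ _).preimage
      (Incidence.toSegre ι (𝟙 (projectiveSpace m k))).left.continuous⟩

/-- The incidence locus is the underlying set of the scheme-theoretic incidence correspondence of
`Motives/ProjectiveIncidence` (`ι` a closed immersion). [folklore] -/
theorem coe_locus_eq_range [IsClosedImmersion ι.left] :
    (locus ι a : Set (X ⊗ projectiveSpace m k).left) =
      Set.range (Incidence.emb ι (𝟙 (projectiveSpace m k)) (forms a)).left := by
  haveI : IsClosedImmersion (𝟙 (projectiveSpace m k) : projectiveSpace m k ⟶ _).left := by
    rw [Over.id_left]; infer_instance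
  rw [Incidence.range_emb]
  rfl

/-- The ideal sheaf of the reduced induced closed subscheme structure on the incidence locus.
[cite: Hartshorne1977, II Example 3.2.6] -/
def totalIdeal : (X ⊗ projectiveSpace m k).left.IdealSheafData :=
  Scheme.IdealSheafData.vanishingIdeal (locus ι a)

/-- **The total space `X̃ ⊆ X × ℙᵐ` of the net of linear sections** of `X ↪ ℙᴺ` cut out by the
linear forms `a₀, …, a_m`: the incidence locus with its reduced induced structure (for a regular
centre `X ∩ V(a₀, …, a_m)` this is the blow-up of `X` along it, Hartshorne II Example 7.17.3; the
fibre of `π = pr₂` over `b` is the linear section `X ∩ {aᵢ b_{i'} = a_{i'} bᵢ}`).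
[cite: Hartshorne1977, II Example 7.17.3] -/
def total : SchemeOver k :=
  Over.mk ((totalIdeal ι a).subschemeι ≫ (X ⊗ projectiveSpace m k).hom)

/-- The closed immersion `X̃ ⟶ X ×ₖ ℙᵐ` over `k`. [folklore] -/
def emb : total ι a ⟶ X ⊗ projectiveSpace m k :=
  Over.homMk (totalIdeal ι a).subschemeι rfl

/-- `emb` on underlying schemes (`rfl`). [folklore] -/
@[simp]
theorem emb_left : (emb ι a).left = (totalIdeal ι a).subschemeι := rfl

/-- `X̃ ⟶ X ×ₖ ℙᵐ` is a closed immersion. [folklore] -/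
instance isClosedImmersion_emb_left : IsClosedImmersion (emb ι a).left :=
  inferInstanceAs (IsClosedImmersion (totalIdeal ι a).subschemeι)

/-- The image of `X̃ ⟶ X ×ₖ ℙᵐ` is the incidence locus. [folklore] -/
theorem range_emb : Set.range (emb ι a).left = (locus ι a : Set _) := by
  refine (Scheme.IdealSheafData.range_subschemeι (totalIdeal ι a)).trans ?_
  rw [totalIdeal, Scheme.IdealSheafData.coe_support_vanishingIdeal]

/-- **The blow-down `σ = pr₁ : X̃ → X`.** [cite: Hartshorne1977, II Example 7.17.3] -/
def blowDown : total ι a ⟶ X := emb ι a ≫ fst X (projectiveSpace m k)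

/-- **The net map `π = pr₂ : X̃ → ℙᵐ`.** [cite: Hartshorne1977, II Example 7.17.3] -/
def proj : total ι a ⟶ projectiveSpace m k := emb ι a ≫ snd X (projectiveSpace m k)

/-- Unfolding: `σ = emb ≫ pr₁`. [folklore] -/
@[simp] theorem emb_fst : emb ι a ≫ fst X _ = blowDown ι a := rfl

/-- Unfolding: `π = emb ≫ pr₂`. [folklore] -/
@[simp] theorem emb_snd : emb ι a ≫ snd X _ = proj ι a := rfl

/-- Unfolding: `σ = emb ≫ pr₁` on underlying schemes. [folklore] -/
theorem blowDown_left :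
    (blowDown ι a).left = (totalIdeal ι a).subschemeι ≫ pullback.fst X.hom (projectiveSpace m k).hom := rfl

/-- Unfolding: `π = emb ≫ pr₂` on underlying schemes. [folklore] -/
theorem proj_left :
    (proj ι a).left = (totalIdeal ι a).subschemeι ≫ pullback.snd X.hom (projectiveSpace m k).hom := rfl

/-- `X̃` is projective over `k` when `X` is. [cite: Hartshorne1977, II Ex. 4.9] -/
theorem isProjectiveOver_total (hX : IsProjectiveOver X) : IsProjectiveOver (total ι a) := by
  obtain ⟨m', κ, hκ⟩ := hX.tensor (⟨m, 𝟙 _, by rw [Over.id_left]; infer_instance⟩ :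
    IsProjectiveOver (projectiveSpace m k))
  exact ⟨m', emb ι a ≫ κ, by rw [Over.comp_left]; infer_instance⟩

/-- `π : X̃ → ℙᵐ` is proper when `X → Spec k` is. [folklore] -/
theorem isProper_proj_left [IsProper X.hom] : IsProper (proj ι a).left := by
  have h₁ : IsProper (totalIdeal ι a).subschemeι := inferInstance
  have h₂ : IsProper (pullback.snd X.hom (projectiveSpace m k).hom) := inferInstance
  exact MorphismProperty.comp_mem @IsProper _ _ h₁ h₂

/-- `σ : X̃ → X` is proper. [folklore] -/
theorem isProper_blowDown_left : IsProper (blowDown ι a).left := by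
  have h₁ : IsProper (totalIdeal ι a).subschemeι := inferInstance
  have h₂ : IsProper (pullback.fst X.hom (projectiveSpace m k).hom) := inferInstance
  exact MorphismProperty.comp_mem @IsProper _ _ h₁ h₂

/-- `X̃` is reduced (it carries the reduced induced structure). [cite: Hartshorne1977, II Example 3.2.6] -/
instance isReduced_total_left : IsReduced (total ι a).left := by
  change IsReduced (totalIdeal ι a).subscheme
  haveI : ∀ U, IsReduced ((totalIdeal ι a).subschemeCover.openCover.X U) := by
    intro (U : (X ⊗ projectiveSpace m k).left.affineOpens)
    change IsReduced (Spec (.of (Γ((X ⊗ projectiveSpace m k).left, (U : (X ⊗ projectiveSpace m k).left.Opens)) ⧸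
      (totalIdeal ι a).ideal U)))
    haveI : _root_.IsReduced (Γ((X ⊗ projectiveSpace m k).left, (U : (X ⊗ projectiveSpace m k).left.Opens)) ⧸
        (totalIdeal ι a).ideal U) := by
      rw [← Ideal.isRadical_iff_quotient_reduced, totalIdeal, Scheme.IdealSheafData.vanishingIdeal_ideal]
      exact PrimeSpectrum.isRadical_vanishingIdeal _
    infer_instance
  exact IsReduced.of_openCover _ (totalIdeal ι a).subschemeCover.openCover

/-! ### The piece of `X̃` over a chart -/

variable (j : Fin (N + 1)) (l : Fin (m + 1)) (X' : X.left.affineOpens)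

/-- **The incidence locus in the coordinates of the chart** `X' ×ₖ D₊(y_l)`, `X' ⊆ ι⁻¹D₊(x_j)`: the
common zero locus of the incidence functions `aᵢ/x_j ⊗ y_{i'}/y_l - a_{i'}/x_j ⊗ yᵢ/y_l`.
[cite: Hartshorne1977, II Example 7.17.3] -/
theorem preimage_chartImm_locus (hX' : (X' : X.left.Opens) ≤ ι.left ⁻¹ᵁ Proj.basicOpen 𝒜 (MvPolynomial.X j)) :
    chartImm X l X' ⁻¹' (locus ι a : Set (X ⊗ projectiveSpace m k).left) =
      PrimeSpectrum.zeroLocus (Set.range (incFun ι l a hX')) := by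
  ext x
  have key : ∀ p, x ∈ chartImm X l X' ⁻¹' ((Incidence.toSegre ι (𝟙 (projectiveSpace m k))).left ⁻¹'
      ProjectiveSpectrum.zeroLocus (Segre.grading (Fin (N * m + N + m + 1)) k) {incidenceForm a p}) ↔
        x ∈ PrimeSpectrum.zeroLocus {incFun ι l a hX' p} := fun p =>
    Set.ext_iff.mp (preimage_chartImm_preimage_zeroLocus ι j l X' hX' (isHomogeneous_incidenceForm a p) _
      (segreRingHom_incidenceForm ι j l X' a hX' p)) x
  have e1 : x ∈ chartImm X l X' ⁻¹' (locus ι a : Set (X ⊗ projectiveSpace m k).left) ↔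
      forms a ⊆ ((Incidence.toSegre ι (𝟙 (projectiveSpace m k))).left (chartImm X l X' x)).asHomogeneousIdeal :=
    Iff.rfl
  have e2 : ∀ p, x ∈ chartImm X l X' ⁻¹' ((Incidence.toSegre ι (𝟙 (projectiveSpace m k))).left ⁻¹'
      ProjectiveSpectrum.zeroLocus (Segre.grading (Fin (N * m + N + m + 1)) k) {incidenceForm a p}) ↔
        {incidenceForm a p} ⊆
          (((Incidence.toSegre ι (𝟙 (projectiveSpace m k))).left (chartImm X l X' x)).asHomogeneousIdeal :
            Set (MvPolynomial (Fin (N * m + N + m + 1)) k)) := fun p => Iff.rfl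
  refine e1.trans ?_
  refine (Set.range_subset_iff (f := incidenceForm a)).trans ?_
  refine Iff.trans ?_ (PrimeSpectrum.mem_zeroLocus _ _).symm
  refine Iff.trans ?_ (Set.range_subset_iff (f := incFun ι l a hX')).symm
  refine forall_congr' fun p => ?_
  exact Set.singleton_subset_iff.symm.trans ((e2 p).symm.trans ((key p).trans
    ((PrimeSpectrum.mem_zeroLocus _ _).trans Set.singleton_subset_iff)))

variable (X) in
/-- **The piece `X̃ ∩ (X' ×ₖ D₊(y_l))` of the total space over the affine chart**, as a scheme: the
fibre product of `X̃ ↪ X ×ₖ ℙᵐ` with the chart. [folklore] -/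
def chartSection : Scheme.{u} :=
  pullback (emb ι a).left (chartImm X l X')

/-- The closed immersion `X̃ ∩ (X' ×ₖ D₊(y_l)) ↪ X' ×ₖ D₊(y_l) = Spec (Γ(X, X') ⊗ₖ R)`. [folklore] -/
def chartSectionι : chartSection X ι a l X' ⟶ Spec (.of (chartRing (X := X) l X')) :=
  pullback.snd (emb ι a).left (chartImm X l X')

/-- The open immersion `X̃ ∩ (X' ×ₖ D₊(y_l)) ↪ X̃`. [folklore] -/
def chartSectionToTotal : chartSection X ι a l X' ⟶ (total ι a).left :=
  pullback.fst (emb ι a).left (chartImm X l X')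

/-- `chartSectionι` is a closed immersion. [folklore] -/
instance isClosedImmersion_chartSectionι : IsClosedImmersion (chartSectionι ι a l X') :=
  MorphismProperty.pullback_snd (P := @IsClosedImmersion) _ _ inferInstance

/-- `chartSectionToTotal` is an open immersion. [folklore] -/
instance isOpenImmersion_chartSectionToTotal : IsOpenImmersion (chartSectionToTotal ι a l X') :=
  MorphismProperty.pullback_fst (P := @IsOpenImmersion) _ _ (isOpenImmersion_chartImm l X')

/-- The piece is reduced. [folklore] -/
instance isReduced_chartSection : IsReduced (chartSection X ι a l X') :=
  isReduced_of_isOpenImmersion (chartSectionToTotal ι a l X')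

/-- The square `X̃ ∩ (X' × D₊(y_l)) → X̃ → X × ℙᵐ` = `… → Spec (Γ(X, X') ⊗ R) → X × ℙᵐ` commutes. [folklore] -/
@[reassoc]
theorem chartSectionToTotal_emb :
    chartSectionToTotal ι a l X' ≫ (emb ι a).left = chartSectionι ι a l X' ≫ chartImm X l X' :=
  pullback.condition

/-- The image of `X̃ ∩ (X' ×ₖ D₊(y_l))` in the chart is the zero locus of the incidence functions.
[folklore] -/
theorem range_chartSectionι (hX' : (X' : X.left.Opens) ≤ ι.left ⁻¹ᵁ Proj.basicOpen 𝒜 (MvPolynomial.X j)) :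
    Set.range (chartSectionι ι a l X') = PrimeSpectrum.zeroLocus (Set.range (incFun ι l a hX')) := by
  refine (Scheme.Pullback.range_snd (emb ι a).left (chartImm X l X')).trans ?_
  rw [range_emb]
  exact preimage_chartImm_locus ι a j l X' hX'

/-- The image of `X̃ ∩ (X' ×ₖ D₊(y_l))` in `X̃` is `σ⁻¹(X') ∩ π⁻¹(D₊(y_l))`. [folklore] -/
theorem range_chartSectionToTotal :
    Set.range (chartSectionToTotal ι a l X') =
      (blowDown ι a).left ⁻¹' ((X' : X.left.Opens) : Set X.left) ∩
        (proj ι a).left ⁻¹'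
          ((Proj.basicOpen (Segre.grading (Fin (m + 1)) k) (MvPolynomial.X l) :
            (Proj (Segre.grading (Fin (m + 1)) k)).Opens) : Set (Proj (Segre.grading (Fin (m + 1)) k))) := by
  refine (Scheme.Pullback.range_fst (emb ι a).left (chartImm X l X')).trans ?_
  have h := range_chartImm (X := X) l X'
  erw [h]
  rfl

/-- **Local structure of the total space**: any REDUCED closed subscheme `C ↪ Spec (Γ(X, X') ⊗ₖ R)`
supported on the zero locus of the incidence functions is isomorphic, over the chart, to the piece
`X̃ ∩ (X' ×ₖ D₊(y_l))` (uniqueness of the reduced closed subscheme structure).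
[cite: Hartshorne1977, II Example 3.2.6] -/
theorem exists_iso_chartSection {C : Scheme.{u}} (γ : C ⟶ Spec (.of (chartRing (X := X) l X')))
    [IsClosedImmersion γ] [IsReduced C]
    (hX' : (X' : X.left.Opens) ≤ ι.left ⁻¹ᵁ Proj.basicOpen 𝒜 (MvPolynomial.X j))
    (hγ : Set.range γ = PrimeSpectrum.zeroLocus (Set.range (incFun ι l a hX'))) :
    ∃ e : C ≅ chartSection X ι a l X', e.hom ≫ chartSectionι ι a l X' = γ :=
  exists_iso_of_isClosedImmersion_of_range_eq (chartSectionι ι a l X') γ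
    ((range_chartSectionι ι a j l X' hX').trans hγ.symm)

end Total

/-! ### The local model: the affine blowup algebra `Γ(X, X')[I/a_l]` -/

section Model

open Literature.AlgebraicGeometry.Resolution

variable (a : Fin (m + 1) → Fin (N + 1) → k) (j : Fin (N + 1)) (l : Fin (m + 1)) (X' : X.left.affineOpens)

/-- The chart ring in polynomial coordinates over `Γ(X, X')`:
`Γ(X, X') ⊗ₖ (k[y]_{(y_l)})₀ ≃ Γ(X, X')[T_i : i ≠ l]`, `1 ⊗ yᵢ/y_l ↦ T_i`. [folklore] -/
def polyEquiv : chartRing (X := X) l X' ≃ₐ[Γ(X.left, (X' : X.left.Opens))]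
    MvPolynomial {i : Fin (m + 1) // i ≠ l} Γ(X.left, (X' : X.left.Opens)) :=
  (chartRingEquiv (N := m) l X').trans
    ((MvPolynomial.algebraTensorAlgEquiv k Γ(X.left, (X' : X.left.Opens))).trans
      (MvPolynomial.renameEquiv Γ(X.left, (X' : X.left.Opens)) (finSuccAboveEquiv l)))

/-- `polyEquiv (u ⊗ r) = u • (chartBaseEquiv r)(T)`. [folklore] -/
theorem polyEquiv_tmul (u : Γ(X.left, (X' : X.left.Opens))) (r : chartBaseRing (k := k) m l) :
    polyEquiv l X' (u ⊗ₜ[k] r) =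
      u • MvPolynomial.rename (finSuccAboveEquiv l)
        (MvPolynomial.map (algebraMap k Γ(X.left, (X' : X.left.Opens))) (chartBaseEquiv m l r)) := by
  simp only [polyEquiv, AlgEquiv.trans_apply, chartRingEquiv_tmul, MvPolynomial.algebraTensorAlgEquiv_tmul,
    map_smul]
  rfl

/-- `polyEquiv (u ⊗ 1) = C u`. [folklore] -/
@[simp]
theorem polyEquiv_tmul_one (u : Γ(X.left, (X' : X.left.Opens))) :
    polyEquiv l X' (u ⊗ₜ[k] (1 : chartBaseRing m l)) = MvPolynomial.C u := by
  rw [polyEquiv_tmul, map_one, map_one, map_one, MvPolynomial.smul_eq_C_mul, mul_one]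

/-- `polyEquiv (u ⊗ yᵢ/y_l) = u · Tᵢ` for `i ≠ l`. [folklore] -/
theorem polyEquiv_tmul_frac (u : Γ(X.left, (X' : X.left.Opens))) {i : Fin (m + 1)} (hi : i ≠ l) :
    polyEquiv l X' (u ⊗ₜ[k] Segre.frac k l i) = MvPolynomial.C u * MvPolynomial.X ⟨i, hi⟩ := by
  obtain ⟨t, rfl⟩ : ∃ t : Fin m, l.succAbove t = i := Fin.exists_succAbove_eq hi
  rw [polyEquiv_tmul, chartBaseEquiv_frac_succAbove, MvPolynomial.map_X, MvPolynomial.rename_X,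
    MvPolynomial.smul_eq_C_mul]
  rfl

/-- `polyEquiv (u ⊗ y_l/y_l) = C u`. [folklore] -/
theorem polyEquiv_tmul_frac_self (u : Γ(X.left, (X' : X.left.Opens))) :
    polyEquiv l X' (u ⊗ₜ[k] Segre.frac k l l) = MvPolynomial.C u := by
  rw [Segre.frac_self, polyEquiv_tmul_one]

variable {j X'} in
/-- The regular functions `aᵢ(x)/x_j ∈ Γ(X, X')` of the `m + 1` linear forms: the generators of the
ideal of the centre `X ∩ V(a₀, …, a_m)` on the chart. [folklore] -/
def centre (hX' : (X' : X.left.Opens) ≤ ι.left ⁻¹ᵁ Proj.basicOpen 𝒜 (MvPolynomial.X j)) :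
    Fin (m + 1) → Γ(X.left, (X' : X.left.Opens)) :=
  fun i => uForm ι j hX' (a i)

/-- In polynomial coordinates the incidence function `aᵢ/x_j ⊗ 1 - a_l/x_j ⊗ yᵢ/y_l` (`i ≠ l`) is
the relation `aᵢ/x_j - a_l/x_j · Tᵢ` of the affine blowup algebra. [folklore] -/
theorem polyEquiv_incFun_left (hX' : (X' : X.left.Opens) ≤ ι.left ⁻¹ᵁ Proj.basicOpen 𝒜 (MvPolynomial.X j))
    (i : {i : Fin (m + 1) // i ≠ l}) :
    polyEquiv l X' (incFun ι l a hX' (i.1, l)) = blowupAlgebra.rel (centre ι a hX') l i := by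
  rw [incFun, map_sub, polyEquiv_tmul_frac_self, polyEquiv_tmul_frac l X' _ i.2, blowupAlgebra.rel]
  rfl

/-- The polynomial coordinate of `yᵢ/y_l`: `Tᵢ` for `i ≠ l` and `1` for `i = l`. [folklore] -/
def tv (i : Fin (m + 1)) : MvPolynomial {i : Fin (m + 1) // i ≠ l} Γ(X.left, (X' : X.left.Opens)) :=
  if h : i = l then 1 else MvPolynomial.X ⟨i, h⟩

/-- `polyEquiv (u ⊗ yᵢ/y_l) = u · tv i`. [folklore] -/
theorem polyEquiv_tmul_frac' (u : Γ(X.left, (X' : X.left.Opens))) (i : Fin (m + 1)) :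
    polyEquiv l X' (u ⊗ₜ[k] Segre.frac k l i) = MvPolynomial.C u * tv l X' i := by
  by_cases h : i = l
  · subst h
    rw [polyEquiv_tmul_frac_self, tv, dif_pos rfl, mul_one]
  · rw [polyEquiv_tmul_frac l X' u h, tv, dif_neg h]

/-- The relation `aᵢ/x_j - a_l/x_j · tv i` lies in the ideal of relations (it is a relation for
`i ≠ l` and `0` for `i = l`). [folklore] -/
theorem rel'_mem (hX' : (X' : X.left.Opens) ≤ ι.left ⁻¹ᵁ Proj.basicOpen 𝒜 (MvPolynomial.X j)) (i : Fin (m + 1)) :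
    MvPolynomial.C (centre ι a hX' i) - MvPolynomial.C (centre ι a hX' l) * tv l X' i ∈
      Ideal.span (Set.range (blowupAlgebra.rel (centre ι a hX') l)) := by
  by_cases h : i = l
  · subst h
    rw [tv, dif_pos rfl, mul_one, sub_self]
    exact Ideal.zero_mem _
  · rw [tv, dif_neg h]
    exact Ideal.subset_span ⟨⟨i, h⟩, rfl⟩

/-- Every incidence function lies, in polynomial coordinates, in the ideal of the relations
`aᵢ/x_j - a_l/x_j · Tᵢ`. [folklore] -/
theorem polyEquiv_incFun_mem (hX' : (X' : X.left.Opens) ≤ ι.left ⁻¹ᵁ Proj.basicOpen 𝒜 (MvPolynomial.X j))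
    (p : Fin (m + 1) × Fin (m + 1)) :
    polyEquiv l X' (incFun ι l a hX' p) ∈ Ideal.span (Set.range (blowupAlgebra.rel (centre ι a hX') l)) := by
  have e : polyEquiv l X' (incFun ι l a hX' p) =
      (MvPolynomial.C (centre ι a hX' p.1) - MvPolynomial.C (centre ι a hX' l) * tv l X' p.1) * tv l X' p.2 -
      (MvPolynomial.C (centre ι a hX' p.2) - MvPolynomial.C (centre ι a hX' l) * tv l X' p.2) * tv l X' p.1 := by
    rw [incFun, map_sub, polyEquiv_tmul_frac', polyEquiv_tmul_frac']
    change MvPolynomial.C (centre ι a hX' p.1) * tv l X' p.2 - MvPolynomial.C (centre ι a hX' p.2) * tv l X' p.1 = _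
    ring
  rw [e]
  exact Ideal.sub_mem _ (Ideal.mul_mem_right _ _ (rel'_mem ι a j l X' hX' p.1))
    (Ideal.mul_mem_right _ _ (rel'_mem ι a j l X' hX' p.2))

/-- **The ideal of the incidence functions, in polynomial coordinates, is the ideal of the obvious
relations of the affine blowup algebra.** [folklore] -/
theorem map_polyEquiv_span_incFun (hX' : (X' : X.left.Opens) ≤ ι.left ⁻¹ᵁ Proj.basicOpen 𝒜 (MvPolynomial.X j)) :
    (Ideal.span (Set.range (incFun ι l a hX'))).map (polyEquiv l X') =
      Ideal.span (Set.range (blowupAlgebra.rel (centre ι a hX') l)) := by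
  apply le_antisymm
  · rw [Ideal.map_span, Ideal.span_le]
    rintro _ ⟨_, ⟨p, rfl⟩, rfl⟩
    exact polyEquiv_incFun_mem ι a j l X' hX' p
  · rw [Ideal.span_le]
    rintro _ ⟨i, rfl⟩
    rw [SetLike.mem_coe, ← polyEquiv_incFun_left ι a j l X' hX' i, Ideal.map_span]
    exact Ideal.subset_span ⟨_, ⟨(i.1, l), rfl⟩, rfl⟩

/-- **The local model ring map** `Γ(X, X') ⊗ₖ (k[y]_{(y_l)})₀ → Γ(X, X')[I/(a_l/x_j)]`,
`u ⊗ yᵢ/y_l ↦ u · (aᵢ/x_j)/(a_l/x_j)`: polynomial coordinates followed by the evaluation map of the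
affine blowup algebra of `Γ(X, X')` along `I = (a₀/x_j, …, a_m/x_j)` at `a_l/x_j`.
[cite: Hartshorne1977, II Example 7.17.3] -/
def modelHom (hX' : (X' : X.left.Opens) ≤ ι.left ⁻¹ᵁ Proj.basicOpen 𝒜 (MvPolynomial.X j)) :
    chartRing (X := X) l X' →ₐ[Γ(X.left, (X' : X.left.Opens))]
      blowupAlgebra (Ideal.span (Set.range (centre ι a hX'))) (centre ι a hX' l) :=
  (blowupAlgebra.eval (centre ι a hX') l).comp (polyEquiv l X').toAlgHom

/-- The model ring map is surjective. [folklore] -/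
theorem modelHom_surjective (hX' : (X' : X.left.Opens) ≤ ι.left ⁻¹ᵁ Proj.basicOpen 𝒜 (MvPolynomial.X j)) :
    Function.Surjective (modelHom ι a j l X' hX') :=
  (blowupAlgebra.eval_surjective _ l).comp (polyEquiv l X').surjective

/-- **The local model** `Spec Γ(X, X')[I/(a_l/x_j)] ↪ X' ×ₖ D₊(y_l)` of the total space over the chart.
[cite: Hartshorne1977, II Example 7.17.3] -/
def modelImm (hX' : (X' : X.left.Opens) ≤ ι.left ⁻¹ᵁ Proj.basicOpen 𝒜 (MvPolynomial.X j)) :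
    Spec (.of (blowupAlgebra (Ideal.span (Set.range (centre ι a hX'))) (centre ι a hX' l))) ⟶
      Spec (.of (chartRing (X := X) l X')) :=
  Spec.map (CommRingCat.ofHom (modelHom ι a j l X' hX').toRingHom)

/-- The local model is a closed immersion. [folklore] -/
instance isClosedImmersion_modelImm (hX' : (X' : X.left.Opens) ≤ ι.left ⁻¹ᵁ Proj.basicOpen 𝒜 (MvPolynomial.X j)) :
    IsClosedImmersion (modelImm ι a j l X' hX') :=
  IsClosedImmersion.spec_of_surjective _ (modelHom_surjective ι a j l X' hX')

/-- **The image of the local model is the incidence locus of the chart**, when the centre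
`(a₀/x_j, …, a_m/x_j)` is a quasi-regular sequence in `Γ(X, X')`. [cite: StacksProject, Tag 0BIQ] -/
theorem range_modelImm (hX' : (X' : X.left.Opens) ≤ ι.left ⁻¹ᵁ Proj.basicOpen 𝒜 (MvPolynomial.X j))
    (hq : IsQuasiRegular (centre ι a hX')) :
    Set.range (modelImm ι a j l X' hX') = PrimeSpectrum.zeroLocus (Set.range (incFun ι l a hX')) := by
  have hr : Set.range (modelImm ι a j l X' hX') =
      PrimeSpectrum.zeroLocus (RingHom.ker (modelHom ι a j l X' hX').toRingHom : Set (chartRing (X := X) l X')) := by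
    rw [← range_comap_of_surjective _ _ (modelHom_surjective ι a j l X' hX')]
    rfl
  rw [hr, ← PrimeSpectrum.zeroLocus_span (Set.range (incFun ι l a hX'))]
  ext P
  rw [PrimeSpectrum.mem_zeroLocus, PrimeSpectrum.mem_zeroLocus, SetLike.coe_subset_coe, SetLike.coe_subset_coe]
  -- transport along `polyEquiv`: `P ↦ P.map polyEquiv`
  have hP : (P.asIdeal.map (polyEquiv l X')).IsPrime :=
    Ideal.map_isPrime_of_equiv (polyEquiv l X')
  have hcomap : P.asIdeal =
      (P.asIdeal.map (polyEquiv l X')).comap (polyEquiv l X') :=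
    (Ideal.comap_map_of_bijective _ (polyEquiv l X').bijective).symm
  have h1 : RingHom.ker (modelHom ι a j l X' hX').toRingHom ≤ P.asIdeal ↔
      RingHom.ker (blowupAlgebra.eval (centre ι a hX') l).toRingHom ≤
        P.asIdeal.map (polyEquiv l X') := by
    constructor
    · intro h f hf
      have : (polyEquiv l X').symm f ∈ RingHom.ker (modelHom ι a j l X' hX').toRingHom := by
        rw [RingHom.mem_ker] at hf ⊢
        change blowupAlgebra.eval (centre ι a hX') l (polyEquiv l X' ((polyEquiv l X').symm f)) = 0
        rwa [AlgEquiv.apply_symm_apply]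
      have h2 := h this
      rw [hcomap, Ideal.mem_comap] at h2
      change polyEquiv l X' ((polyEquiv l X').symm f) ∈ _ at h2
      rwa [AlgEquiv.apply_symm_apply] at h2
    · intro h f hf
      rw [hcomap, Ideal.mem_comap]
      apply h
      rw [RingHom.mem_ker] at hf ⊢
      exact hf
  have h2 : Ideal.span (Set.range (incFun ι l a hX')) ≤ P.asIdeal ↔
      Ideal.span (Set.range (blowupAlgebra.rel (centre ι a hX') l)) ≤
        P.asIdeal.map (polyEquiv l X') := by
    rw [← map_polyEquiv_span_incFun ι a j l X' hX']
    constructor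
    · exact fun h => Ideal.map_mono h
    · intro h
      rw [hcomap, ← Ideal.map_le_iff_le_comap]
      exact h
  rw [h1, h2]
  have h3 := Set.ext_iff.mp (blowupAlgebra.zeroLocus_ker_eval (centre ι a hX') l hq)
    ⟨P.asIdeal.map (polyEquiv l X'), hP⟩
  rw [PrimeSpectrum.mem_zeroLocus, PrimeSpectrum.mem_zeroLocus, SetLike.coe_subset_coe] at h3
  rw [Ideal.span_le]
  exact h3

/-- The local model is reduced when `Γ(X, X')` is (a subring of a localisation). [folklore] -/
instance isReduced_model [IsReduced X.left] (hX' : (X' : X.left.Opens) ≤ ι.left ⁻¹ᵁ Proj.basicOpen 𝒜 (MvPolynomial.X j)) :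
    IsReduced (Spec (.of (blowupAlgebra (Ideal.span (Set.range (centre ι a hX'))) (centre ι a hX' l)))) := by
  haveI : _root_.IsReduced Γ(X.left, (X' : X.left.Opens)) := inferInstance
  haveI : _root_.IsReduced (blowupAlgebra (Ideal.span (Set.range (centre ι a hX'))) (centre ι a hX' l)) :=
    isReduced_of_injective (blowupAlgebra (Ideal.span (Set.range (centre ι a hX'))) (centre ι a hX' l)).val
      Subtype.val_injective
  infer_instance

/-- **Local structure of the total space**: over a chart `X' ×ₖ D₊(y_l)`, `X' ⊆ ι⁻¹D₊(x_j)` affine,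
on which the centre `(a₀/x_j, …, a_m/x_j)` is a quasi-regular sequence and `X` is reduced, the piece
`X̃ ∩ (X' ×ₖ D₊(y_l))` of the total space is the spectrum of the affine blowup algebra
`Γ(X, X')[I/(a_l/x_j)]` (the chart `D₊(a_l)` of the blow-up of `X'` along the centre).
[cite: Hartshorne1977, II Example 7.17.3] -/
theorem exists_modelIso [IsReduced X.left]
    (hX' : (X' : X.left.Opens) ≤ ι.left ⁻¹ᵁ Proj.basicOpen 𝒜 (MvPolynomial.X j))
    (hq : IsQuasiRegular (centre ι a hX')) :
    ∃ e : Spec (.of (blowupAlgebra (Ideal.span (Set.range (centre ι a hX'))) (centre ι a hX' l))) ≅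
        chartSection X ι a l X',
      e.hom ≫ chartSectionι ι a l X' = modelImm ι a j l X' hX' :=
  exists_iso_chartSection ι a j l X' (modelImm ι a j l X' hX') hX' (range_modelImm ι a j l X' hX' hq)

/-- The local model followed by the chart and the first projection is `Spec` of the structure map
`Γ(X, X') → Γ(X, X')[I/(a_l/x_j)]` followed by `X' ↪ X`. [folklore] -/
@[reassoc]
theorem modelImm_chartImm_fst (hX' : (X' : X.left.Opens) ≤ ι.left ⁻¹ᵁ Proj.basicOpen 𝒜 (MvPolynomial.X j)) :
    modelImm ι a j l X' hX' ≫ chartImm X l X' ≫ pullback.fst X.hom (projectiveSpace m k).hom =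
      Spec.map (CommRingCat.ofHom (algebraMap Γ(X.left, (X' : X.left.Opens))
        (blowupAlgebra (Ideal.span (Set.range (centre ι a hX'))) (centre ι a hX' l)))) ≫ X'.2.fromSpec := by
  rw [chartImm_fst, modelImm, ← Spec.map_comp_assoc, ← CommRingCat.ofHom_comp]
  have h : (modelHom ι a j l X' hX').toRingHom.comp (algebraMap _ (chartRing (X := X) l X')) =
      algebraMap _ _ := (modelHom ι a j l X' hX').comp_algebraMap
  rw [h]

end Model

/-! ### Over the complement of the centre -/

section OffCentre

open Literature.AlgebraicGeometry.Resolution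

variable (a : Fin (m + 1) → Fin (N + 1) → k) (j : Fin (N + 1)) (l : Fin (m + 1)) (X' : X.left.affineOpens)

omit [Field k] in
/-- Every point of `ℙᵐ_k` lies in some standard chart `D₊(yᵢ)`. [cite: Hartshorne1977, II Prop. 2.5] -/
theorem exists_mem_basicOpen [Field k] (p : (projectiveSpace m k).left) :
    ∃ i : Fin (m + 1), p ∈ Proj.basicOpen (Segre.grading (Fin (m + 1)) k) (MvPolynomial.X i) :=
  UniversalHyperplaneSection.exists_mem_basicOpen_X p

/-- Points of the chart: `yᵢ/y_l` vanishes at `chartβ y` iff `1 ⊗ yᵢ/y_l` vanishes at `y`. [folklore] -/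
theorem frac_mem_chartβ_iff (y : Spec (.of (chartRing (X := X) l X'))) (i : Fin (m + 1)) :
    Segre.frac k l i ∈ ((chartβ l X') y).asIdeal ↔
      (1 : Γ(X.left, (X' : X.left.Opens))) ⊗ₜ[k] Segre.frac k l i ∈ y.asIdeal := by
  rw [chartβ, Spec.map_apply]
  simp only [PrimeSpectrum.comap_asIdeal, Ideal.mem_comap]
  exact Iff.rfl

/-- A point of `X̃` over `X'` whose image in `ℙᵐ` lies in `D₊(y_{l'})` comes from a point `y` of the
chart `X' × D₊(y_{l'})` in the zero locus of the incidence functions. [folklore] -/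
theorem exists_chart_point {l' : Fin (m + 1)}
    (hX' : (X' : X.left.Opens) ≤ ι.left ⁻¹ᵁ Proj.basicOpen 𝒜 (MvPolynomial.X j))
    (z : (total ι a).left) (hz : (blowDown ι a).left z ∈ (X' : X.left.Opens))
    (hl' : (proj ι a).left z ∈ Proj.basicOpen (Segre.grading (Fin (m + 1)) k) (MvPolynomial.X l')) :
    ∃ y : Spec (.of (chartRing (X := X) l' X')), chartImm X l' X' y = (emb ι a).left z ∧
      y ∈ PrimeSpectrum.zeroLocus (Set.range (incFun ι l' a hX')) := by
  have hzr : (emb ι a).left z ∈ Set.range (chartImm X l' X') := by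
    have h := range_chartImm (X := X) l' X'
    erw [h]
    exact ⟨hz, hl'⟩
  obtain ⟨y, hy⟩ := hzr
  refine ⟨y, hy, ?_⟩
  rw [← preimage_chartImm_locus ι a j l' X' hX']
  change chartImm X l' X' y ∈ (locus ι a : Set (X ⊗ projectiveSpace m k).left)
  rw [hy, ← range_emb]
  exact ⟨z, rfl⟩

/-- **Over `X ∖ V(a_l)` the total space lies in `X × D₊(y_l)`**: if `a_l/x_j` is a unit on `X'`, every
point of `X̃` over `X'` maps into `D₊(y_l) ⊆ ℙᵐ` (the incidence equation `a_l y_{l'} = a_{l'} y_l`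
at a point with `y_{l'} ≠ 0` forces `y_l ≠ 0`). [cite: Hartshorne1977, II Example 7.17.3] -/
theorem proj_mem_basicOpen_of_isUnit
    (hX' : (X' : X.left.Opens) ≤ ι.left ⁻¹ᵁ Proj.basicOpen 𝒜 (MvPolynomial.X j))
    (hu : IsUnit (centre ι a hX' l)) (z : (total ι a).left)
    (hz : (blowDown ι a).left z ∈ (X' : X.left.Opens)) :
    (proj ι a).left z ∈ Proj.basicOpen (Segre.grading (Fin (m + 1)) k) (MvPolynomial.X l) := by
  obtain ⟨l', hl'⟩ := exists_mem_basicOpen ((proj ι a).left z)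
  obtain ⟨y, hy, hyz⟩ := exists_chart_point ι a j X' hX' z hz hl'
  -- the incidence function `a_l ⊗ 1 - a_{l'} ⊗ y_l/y_{l'}` vanishes at `y`
  have hmem : incFun ι l' a hX' (l, l') ∈ y.asIdeal := by
    have := (PrimeSpectrum.mem_zeroLocus _ _).mp hyz
    exact this ⟨(l, l'), rfl⟩
  have hnot : (1 : Γ(X.left, (X' : X.left.Opens))) ⊗ₜ[k] Segre.frac k l' l ∉ y.asIdeal := by
    intro h
    apply y.2.ne_top
    rw [Ideal.eq_top_iff_one]
    have hunit : IsUnit ((centre ι a hX' l ⊗ₜ[k] (1 : chartBaseRing (k := k) m l')) : chartRing (X := X) l' X') :=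
      hu.map (Algebra.TensorProduct.includeLeftRingHom (R := k) (A := Γ(X.left, (X' : X.left.Opens)))
        (B := chartBaseRing (k := k) m l'))
    have h1 : (centre ι a hX' l ⊗ₜ[k] (1 : chartBaseRing (k := k) m l') : chartRing (X := X) l' X') ∈ y.asIdeal := by
      have e : (centre ι a hX' l ⊗ₜ[k] (1 : chartBaseRing (k := k) m l') : chartRing (X := X) l' X') =
          incFun ι l' a hX' (l, l') +
          (centre ι a hX' l' ⊗ₜ[k] (1 : chartBaseRing (k := k) m l')) *
            ((1 : Γ(X.left, (X' : X.left.Opens))) ⊗ₜ[k] Segre.frac k l' l) := by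
        rw [incFun, Segre.frac_self, Algebra.TensorProduct.tmul_mul_tmul, mul_one, one_mul]
        change _ = _ - uForm ι j hX' (a l') ⊗ₜ[k] Segre.frac k l' l + uForm ι j hX' (a l') ⊗ₜ[k] Segre.frac k l' l
        rw [sub_add_cancel]
        rfl
      rw [e]
      exact y.asIdeal.add_mem hmem (y.asIdeal.mul_mem_left _ h)
    obtain ⟨v, hv⟩ := hunit.exists_left_inv
    rw [← hv]
    exact y.asIdeal.mul_mem_left _ h1
  -- hence `π z = chartBaseι (chartβ y) ∈ D₊(y_l)`
  have hπ : (proj ι a).left z = chartBaseι m l' (chartβ l' X' y) := by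
    have h := congrArg (fun φ => φ y) (chartImm_snd (X := X) l' X')
    simp only [Scheme.Hom.comp_apply] at h
    rw [← h, hy]
    rfl
  rw [hπ]
  exact (UniversalHyperplaneSection.chartι_mem_basicOpen_iff (chartβ l' X' y) l).2
    ((frac_mem_chartβ_iff l' X' y l).not.mpr hnot)

/-- Hence over `X'` with `a_l/x_j` a unit, `σ⁻¹(X')` is the piece `X̃ ∩ (X' × D₊(y_l))`. [folklore] -/
theorem range_chartSectionToTotal_of_isUnit
    (hX' : (X' : X.left.Opens) ≤ ι.left ⁻¹ᵁ Proj.basicOpen 𝒜 (MvPolynomial.X j))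
    (hu : IsUnit (centre ι a hX' l)) :
    Set.range (chartSectionToTotal ι a l X') = ((blowDown ι a).left ⁻¹ᵁ (X' : X.left.Opens) : Set (total ι a).left) := by
  rw [range_chartSectionToTotal]
  ext z
  constructor
  · rintro ⟨hz, -⟩
    exact hz
  · intro hz
    exact ⟨hz, proj_mem_basicOpen_of_isUnit ι a j l X' hX' hu z hz⟩

/-- For the unit ideal every sequence is quasi-regular. [folklore] -/
theorem isQuasiRegular_of_isUnit {A : Type*} [CommRing A] {n : ℕ} {c : Fin n → A} {i : Fin n}
    (hu : IsUnit (c i)) : IsQuasiRegular c := by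
  intro d F _ _
  have htop : Ideal.span (Set.range c) = ⊤ :=
    Ideal.eq_top_of_isUnit_mem _ (Ideal.subset_span ⟨i, rfl⟩) hu
  rw [htop, Ideal.map_top]
  exact Submodule.mem_top

/-- If `a ∈ R` is a unit, the structure map `R → R[I/a]` is bijective. [folklore] -/
theorem algebraMap_blowupAlgebra_bijective_of_isUnit {R : Type u} [CommRing R] (I : Ideal R) {c : R}
    (hu : IsUnit c) : Function.Bijective (algebraMap R (blowupAlgebra I c)) := by
  have hb := (IsLocalization.atUnit R (Localization.Away c) c hu).bijective
  constructor
  · intro x y hxy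
    exact hb.1 (congrArg Subtype.val hxy)
  · intro z
    obtain ⟨r, hr⟩ := hb.2 z.1
    exact ⟨r, Subtype.ext hr⟩

/-- **Over `X'` with `a_l/x_j` a unit the local model is `X'` itself**: `Spec` of the (bijective)
structure map `Γ(X, X') → Γ(X, X')[I/(a_l/x_j)] = Γ(X, X')`. [folklore] -/
instance isIso_specMap_algebraMap_of_isUnit
    (hX' : (X' : X.left.Opens) ≤ ι.left ⁻¹ᵁ Proj.basicOpen 𝒜 (MvPolynomial.X j))
    [hu : Fact (IsUnit (centre ι a hX' l))] :
    IsIso (Spec.map (CommRingCat.ofHom (algebraMap Γ(X.left, (X' : X.left.Opens))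
      (blowupAlgebra (Ideal.span (Set.range (centre ι a hX'))) (centre ι a hX' l))))) := by
  have hb := algebraMap_blowupAlgebra_bijective_of_isUnit (Ideal.span (Set.range (centre ι a hX'))) hu.out
  haveI : IsIso (CommRingCat.ofHom (algebraMap Γ(X.left, (X' : X.left.Opens))
      (blowupAlgebra (Ideal.span (Set.range (centre ι a hX'))) (centre ι a hX' l)))) :=
    (RingEquiv.ofBijective _ hb).toCommRingCatIso.isIso_hom
  infer_instance

/-- **`σ : X̃ → X` is an isomorphism over `X'`** when `a_l/x_j` is a unit on the affine open
`X' ⊆ ι⁻¹D₊(x_j)` of the reduced scheme `X` (over `X ∖ V(a₀, …, a_m)` the total space is the graph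
of `(a₀ : … : a_m)`). [cite: Hartshorne1977, II Example 7.17.3] -/
theorem isIso_blowDown_restrict_of_isUnit [IsReduced X.left]
    (hX' : (X' : X.left.Opens) ≤ ι.left ⁻¹ᵁ Proj.basicOpen 𝒜 (MvPolynomial.X j))
    (hu : IsUnit (centre ι a hX' l)) :
    IsIso ((blowDown ι a).left ∣_ (X' : X.left.Opens)) := by
  haveI : Fact (IsUnit (centre ι a hX' l)) := ⟨hu⟩
  obtain ⟨e, he⟩ := exists_modelIso ι a j l X' hX' (isQuasiRegular_of_isUnit hu)
  have hcomp : (e.hom ≫ chartSectionToTotal ι a l X') ≫ (blowDown ι a).left =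
      Spec.map (CommRingCat.ofHom (algebraMap Γ(X.left, (X' : X.left.Opens))
        (blowupAlgebra (Ideal.span (Set.range (centre ι a hX'))) (centre ι a hX' l)))) ≫ X'.2.fromSpec := by
    have h1 : chartSectionToTotal ι a l X' ≫ (emb ι a).left ≫ pullback.fst X.hom (projectiveSpace m k).hom =
        chartSectionι ι a l X' ≫ chartImm X l X' ≫ pullback.fst X.hom (projectiveSpace m k).hom :=
      pullback.condition_assoc _
    rw [← modelImm_chartImm_fst ι a j l X' hX', ← he, Category.assoc, Category.assoc]
    exact congrArg (e.hom ≫ ·) h1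
  haveI : IsOpenImmersion ((e.hom ≫ chartSectionToTotal ι a l X') ≫ (blowDown ι a).left) := by
    rw [hcomp]; infer_instance
  refine isIso_morphismRestrict_of_isOpenImmersion (blowDown ι a).left (X' : X.left.Opens)
    (e.hom ≫ chartSectionToTotal ι a l X') ?_ ?_
  · rw [Scheme.Hom.comp_base, TopCat.coe_comp, Set.range_comp,
      Set.range_eq_univ.mpr (show Function.Surjective e.hom.base from (Scheme.homeoOfIso e).surjective),
      Set.image_univ]
    exact range_chartSectionToTotal_of_isUnit ι a j l X' hX' hu
  · rw [hcomp, Scheme.Hom.comp_base, TopCat.coe_comp, Set.range_comp,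
      Set.range_eq_univ.mpr (show Function.Surjective (Spec.map (CommRingCat.ofHom (algebraMap
          Γ(X.left, (X' : X.left.Opens)) (blowupAlgebra (Ideal.span (Set.range (centre ι a hX')))
            (centre ι a hX' l))))).base from (Scheme.homeoOfIso (asIso (Spec.map _))).surjective),
      Set.image_univ]
    exact X'.2.range_fromSpec

end OffCentre

/-! ### `σ` is an isomorphism off the base locus -/

section OffBase

open Literature.AlgebraicGeometry.Resolution
open Literature.AlgebraicGeometry.Morphisms.ProjCech (PP)

variable (a : Fin (m + 1) → Fin (N + 1) → k)

/-- `ι` in the spelling of `Resolution.LinSec` (a morphism to `PP k N = Proj k[x₀, …, x_N]`). [folklore] -/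
abbrev ιPP : X.left ⟶ PP k N := ι.left

/-- `ιPP ι` is affine when `ι.left` is (the same morphism; recorded for instance search, which does
not unfold `projectiveSpace`). [folklore] -/
instance isAffineHom_ιPP [h : IsAffineHom ι.left] : IsAffineHom (ιPP ι) := h

/-- (instance plumbing) `ι` a closed immersion, on the `ιPP` spelling. [folklore] -/
instance isClosedImmersion_ιPP [h : IsClosedImmersion ι.left] : IsClosedImmersion (ιPP ι) := h

/-- **The base locus** `F = X ∩ V(a₀, …, a_m)` of the net, as a (closed) subset of `X`
(`Resolution.LinSec.cutSet`). [cite: Hartshorne1977, II Example 7.17.3] -/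
def baseLocus : Set X.left := LinSec.cutSet (ιPP ι) a

/-- The base locus is closed. [folklore] -/
theorem isClosed_baseLocus : IsClosed (baseLocus ι a) := LinSec.isClosed_cutSet _ a

/-- The complement `X ∖ F` of the base locus, as an open of `X`. [folklore] -/
def offBase : X.left.Opens := ⟨(baseLocus ι a)ᶜ, (isClosed_baseLocus ι a).isOpen_compl⟩

/-- Membership in `X ∖ F`: some form `a_l` does not vanish. [folklore] -/
theorem mem_offBase_iff (x : X.left) : x ∈ offBase ι a ↔ ∃ l, x ∉ LinSec.hyp (ιPP ι) (a l) := by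
  change x ∉ LinSec.cutSet (ιPP ι) a ↔ _
  simp only [LinSec.cutSet, Set.mem_iInter, not_forall]

variable [IsAffineHom (ιPP ι)]

/-- The affine opens `X_{h,l} = ι⁻¹D₊(x_h) ∩ X_{a_l} = X_{(a_l/x_h)}` (basic opens of the affine
charts) covering `X ∖ F`. [folklore] -/
def offBaseChart (h : Fin (N + 1)) (l : Fin (m + 1)) : X.left.affineOpens :=
  ⟨X.left.basicOpen (LinSec.linSec (ιPP ι) h (a l)), (LinSec.isAffineOpen_chart (ιPP ι) h).basicOpen _⟩

/-- `X_{h,l} ⊆ ι⁻¹D₊(x_h)`. [folklore] -/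
theorem offBaseChart_le (h : Fin (N + 1)) (l : Fin (m + 1)) :
    (offBaseChart ι a h l : X.left.Opens) ≤ ι.left ⁻¹ᵁ Proj.basicOpen 𝒜 (MvPolynomial.X h) :=
  X.left.basicOpen_le _

/-- On `X_{h,l}` the function `a_l/x_h` is a unit. [folklore] -/
theorem isUnit_centre_offBaseChart (h : Fin (N + 1)) (l : Fin (m + 1)) :
    IsUnit (centre ι a (offBaseChart_le ι a h l) l) := by
  rw [centre, ← map_linSec]
  exact X.left.toRingedSpace.isUnit_res_basicOpen (LinSec.linSec (ιPP ι) h (a l))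

/-- `X_{h,l} ⊆ X ∖ F`. [folklore] -/
theorem offBaseChart_le_offBase (h : Fin (N + 1)) (l : Fin (m + 1)) :
    (offBaseChart ι a h l : X.left.Opens) ≤ offBase ι a := by
  intro x hx
  rw [mem_offBase_iff]
  refine ⟨l, ?_⟩
  rw [LinSec.mem_hyp_iff, not_not]
  have hx' : x ∈ LinSec.chart (ιPP ι) h ⊓ LinSec.XL (ιPP ι) (a l) := by
    rw [LinSec.chart_inf_XL_eq_basicOpen]; exact hx
  exact hx'.2

/-- The `X_{h,l}` cover `X ∖ F`. [folklore] -/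
theorem iSup_preimage_offBaseChart :
    ⨆ p : Fin (N + 1) × Fin (m + 1), (offBase ι a).ι ⁻¹ᵁ (offBaseChart ι a p.1 p.2 : X.left.Opens) = ⊤ := by
  refine top_le_iff.mp fun x _ => ?_
  obtain ⟨l, hl⟩ := (mem_offBase_iff ι a _).mp x.2
  obtain ⟨h, hh⟩ := LinSec.exists_mem_chart (ιPP ι) ((offBase ι a).ι x)
  rw [LinSec.mem_hyp_iff, not_not] at hl
  have hx : (offBase ι a).ι x ∈ (offBaseChart ι a h l : X.left.Opens) := by
    change _ ∈ X.left.basicOpen _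
    rw [← LinSec.chart_inf_XL_eq_basicOpen]
    exact ⟨hh, hl⟩
  exact TopologicalSpace.Opens.mem_iSup.mpr ⟨(h, l), hx⟩

/-- **`σ : X̃ → X` is an isomorphism over `X ∖ F`** (for `X` reduced): over each `X_{h,l}` it is
(`isIso_blowDown_restrict_of_isUnit`), and being an isomorphism is local on the target.
[cite: Hartshorne1977, II Example 7.17.3] -/
theorem isIso_blowDown_restrict_offBase [IsReduced X.left] :
    IsIso ((blowDown ι a).left ∣_ offBase ι a) := by
  have key : (MorphismProperty.isomorphisms Scheme) ((blowDown ι a).left ∣_ offBase ι a) := by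
    refine IsZariskiLocalAtTarget.of_iSup_eq_top _ (iSup_preimage_offBaseChart ι a) fun p => ?_
    refine ((MorphismProperty.isomorphisms Scheme).arrow_mk_iso_iff
      (morphismRestrictRestrict _ _ _)).mpr ?_
    have he : (offBase ι a).ι ''ᵁ ((offBase ι a).ι ⁻¹ᵁ (offBaseChart ι a p.1 p.2 : X.left.Opens)) =
        (offBaseChart ι a p.1 p.2 : X.left.Opens) := by
      rw [Scheme.Hom.image_preimage_eq_opensRange_inf, Scheme.Opens.opensRange_ι]
      exact inf_eq_right.mpr (offBaseChart_le_offBase ι a p.1 p.2)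
    rw [he]
    exact isIso_blowDown_restrict_of_isUnit ι a p.1 p.2 (offBaseChart ι a p.1 p.2)
      (offBaseChart_le ι a p.1 p.2) (isUnit_centre_offBaseChart ι a p.1 p.2)
  exact key

end OffBase

/-! ### Regularity and irreducibility of the total space from the local structure of the centre -/

section Global

open Literature.AlgebraicGeometry.Resolution
open Literature.AlgebraicGeometry.Morphisms.ProjCech (PP)

variable (a : Fin (m + 1) → Fin (N + 1) → k)

/-- **Local structure hypothesis on the centre** (the output of Bertini's theorem for general
forms `a₀, …, a_m`, cf. `Resolution.LinSec.isGeneric_regular_cut`): every point of the base locus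
`F = X ∩ V(a₀, …, a_m)` has an affine neighbourhood `X' ⊆ ι⁻¹D₊(x_h)` on which the functions
`a₀/x_h, …, a_m/x_h` form a quasi-regular sequence whose quotient ring is regular ("`F` is a regular
closed subscheme of codimension `m + 1`, locally a complete intersection of the forms").
[cite: Hartshorne1977, II Thm. 8.18] -/
structure GoodCentre : Prop where
  /-- local charts with quasi-regular centre and regular quotient -/
  exists_chart : ∀ x ∈ baseLocus ι a, ∃ (h : Fin (N + 1)) (X' : X.left.affineOpens)
    (hX' : (X' : X.left.Opens) ≤ ι.left ⁻¹ᵁ Proj.basicOpen 𝒜 (MvPolynomial.X h)),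
    x ∈ (X' : X.left.Opens) ∧ IsQuasiRegular (centre ι a hX') ∧
      IsRegularRing (Γ(X.left, (X' : X.left.Opens)) ⧸ Ideal.span (Set.range (centre ι a hX')))

/-- The stalks of a scheme at the points of the image of an open immersion from a regular scheme are
regular. [folklore] -/
theorem isRegularLocalRing_stalk_of_mem_range {U T : Scheme.{u}} (jj : U ⟶ T) [IsOpenImmersion jj]
    (hU : Scheme.IsRegular U) {z : T} (hz : z ∈ Set.range jj) : IsRegularLocalRing (T.presheaf.stalk z) := by
  obtain ⟨u, rfl⟩ := hz
  haveI := hU u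
  exact IsRegularLocalRing.of_ringEquiv (asIso (jj.stalkMap u)).commRingCatIsoToRingEquiv.symm

/-- The range of `e.hom ≫ chartSectionToTotal` for an isomorphism `e` onto the chart piece.
[folklore] -/
theorem range_iso_comp_chartSectionToTotal {C : Scheme.{u}} (l : Fin (m + 1)) (X' : X.left.affineOpens)
    (e : C ≅ chartSection X ι a l X') :
    Set.range (e.hom ≫ chartSectionToTotal ι a l X') =
      (blowDown ι a).left ⁻¹' ((X' : X.left.Opens) : Set X.left) ∩
        (proj ι a).left ⁻¹'
          ((Proj.basicOpen (Segre.grading (Fin (m + 1)) k) (MvPolynomial.X l) :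
            (Proj (Segre.grading (Fin (m + 1)) k)).Opens) : Set (Proj (Segre.grading (Fin (m + 1)) k))) := by
  rw [Scheme.Hom.comp_base, TopCat.coe_comp, Set.range_comp,
    Set.range_eq_univ.mpr (show Function.Surjective e.hom.base from (Scheme.homeoOfIso e).surjective),
    Set.image_univ, range_chartSectionToTotal]

/-- `e.hom ≫ chartSectionToTotal ≫ σ = (model → Spec Γ(X, X') → X)` for a model isomorphism `e`.
[folklore] -/
theorem iso_comp_chartSectionToTotal_blowDown {j : Fin (N + 1)} {l : Fin (m + 1)} {X' : X.left.affineOpens}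
    (hX' : (X' : X.left.Opens) ≤ ι.left ⁻¹ᵁ Proj.basicOpen 𝒜 (MvPolynomial.X j))
    (e : Spec (.of (blowupAlgebra (Ideal.span (Set.range (centre ι a hX'))) (centre ι a hX' l))) ≅
      chartSection X ι a l X')
    (he : e.hom ≫ chartSectionι ι a l X' = modelImm ι a j l X' hX') :
    (e.hom ≫ chartSectionToTotal ι a l X') ≫ (blowDown ι a).left =
      Spec.map (CommRingCat.ofHom (algebraMap Γ(X.left, (X' : X.left.Opens))
        (blowupAlgebra (Ideal.span (Set.range (centre ι a hX'))) (centre ι a hX' l)))) ≫ X'.2.fromSpec := by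
  have h1 : chartSectionToTotal ι a l X' ≫ (emb ι a).left ≫ pullback.fst X.hom (projectiveSpace m k).hom =
      chartSectionι ι a l X' ≫ chartImm X l X' ≫ pullback.fst X.hom (projectiveSpace m k).hom :=
    pullback.condition_assoc _
  rw [← modelImm_chartImm_fst ι a j l X' hX', ← he, Category.assoc, Category.assoc]
  exact congrArg (e.hom ≫ ·) h1

variable [IsAffineHom (ιPP ι)]

/-- A point off the base locus lies in some `X_{h,l}`. [folklore] -/
theorem exists_mem_offBaseChart {x : X.left} (hx : x ∉ baseLocus ι a) :
    ∃ (h : Fin (N + 1)) (l : Fin (m + 1)), x ∈ (offBaseChart ι a h l : X.left.Opens) := by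
  obtain ⟨l, hl⟩ := (mem_offBase_iff ι a x).mp hx
  obtain ⟨h, hh⟩ := LinSec.exists_mem_chart (ιPP ι) x
  rw [LinSec.mem_hyp_iff, not_not] at hl
  refine ⟨h, l, ?_⟩
  change x ∈ X.left.basicOpen _
  rw [← LinSec.chart_inf_XL_eq_basicOpen]
  exact ⟨hh, hl⟩

/-- **The total space is regular** when `X` is regular, reduced and locally Noetherian and the centre
has the local structure `GoodCentre`: over the centre the local models are affine blowup algebras of
regular rings along quasi-regular centres with regular quotient, which are regular (Liu Thm. 8.1.19 (a),
tree `blowupAlgebra.isRegularRing`); off the centre they are the affine opens `X_{h,l}` of `X`.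
[cite: Hartshorne1977, II Thm. 8.24 (b)] -/
theorem isRegular_total [IsReduced X.left] [IsLocallyNoetherian X.left] (hreg : Scheme.IsRegular X.left)
    (hF : GoodCentre ι a) : Scheme.IsRegular (total ι a).left := by
  intro z
  obtain ⟨l, hl⟩ := exists_mem_basicOpen ((proj ι a).left z)
  by_cases hx : (blowDown ι a).left z ∈ baseLocus ι a
  · obtain ⟨h, X', hX', hxX', hq, hqr⟩ := hF.exists_chart _ hx
    obtain ⟨e, -⟩ := exists_modelIso ι a h l X' hX' hq
    haveI : IsRegularRing Γ(X.left, (X' : X.left.Opens)) := hreg.isRegularRing_of_isAffineOpen X'.2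
    haveI := hqr
    haveI := blowupAlgebra.isRegularRing (centre ι a hX') l hq
    refine isRegularLocalRing_stalk_of_mem_range (e.hom ≫ chartSectionToTotal ι a l X')
      (Scheme.isRegular_Spec _) ?_
    rw [range_iso_comp_chartSectionToTotal]
    exact ⟨hxX', hl⟩
  · obtain ⟨h, l', hxX'⟩ := exists_mem_offBaseChart ι a hx
    have hu := isUnit_centre_offBaseChart ι a h l'
    obtain ⟨e, -⟩ := exists_modelIso ι a h l' (offBaseChart ι a h l') (offBaseChart_le ι a h l')
      (isQuasiRegular_of_isUnit hu)
    haveI : IsRegularRing Γ(X.left, (offBaseChart ι a h l' : X.left.Opens)) :=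
      hreg.isRegularRing_of_isAffineOpen (offBaseChart ι a h l').2
    haveI : IsRegularRing (blowupAlgebra (Ideal.span (Set.range (centre ι a (offBaseChart_le ι a h l'))))
        (centre ι a (offBaseChart_le ι a h l') l')) :=
      IsRegularRing.of_ringEquiv (RingEquiv.ofBijective _
        (algebraMap_blowupAlgebra_bijective_of_isUnit (Ideal.span (Set.range (centre ι a (offBaseChart_le ι a h l')))) hu))
    refine isRegularLocalRing_stalk_of_mem_range (e.hom ≫ chartSectionToTotal ι a l' (offBaseChart ι a h l'))
      (Scheme.isRegular_Spec _) ?_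
    rw [range_iso_comp_chartSectionToTotal]
    exact ⟨hxX', proj_mem_basicOpen_of_isUnit ι a h l' (offBaseChart ι a h l') (offBaseChart_le ι a h l') hu z hxX'⟩

omit [IsAffineHom (ιPP ι)] in
/-- Over the centre, the local model is the spectrum of a DOMAIN when `Γ(X, X')` is a domain and the
model has a point (the blowup algebra sits in the localisation `Γ(X, X')[x_j/a_l]`, which is then
non-zero). [folklore] -/
theorem isDomain_model_of_nonempty {j : Fin (N + 1)} {l : Fin (m + 1)} {X' : X.left.affineOpens}
    (hX' : (X' : X.left.Opens) ≤ ι.left ⁻¹ᵁ Proj.basicOpen 𝒜 (MvPolynomial.X j))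
    [IsDomain Γ(X.left, (X' : X.left.Opens))]
    (q : PrimeSpectrum (blowupAlgebra (Ideal.span (Set.range (centre ι a hX'))) (centre ι a hX' l))) :
    centre ι a hX' l ≠ 0 ∧
      IsDomain (blowupAlgebra (Ideal.span (Set.range (centre ι a hX'))) (centre ι a hX' l)) := by
  have hc0 : centre ι a hX' l ≠ 0 := by
    intro h0
    have hmem : (0 : Γ(X.left, (X' : X.left.Opens))) ∈ Submonoid.powers (centre ι a hX' l) := by
      rw [← h0]; exact Submonoid.mem_powers _
    haveI := IsLocalization.uniqueOfZeroMem (M := Submonoid.powers (centre ι a hX' l))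
      (S := Localization.Away (centre ι a hX' l)) hmem
    haveI : Subsingleton (blowupAlgebra (Ideal.span (Set.range (centre ι a hX'))) (centre ι a hX' l)) :=
      Subtype.val_injective.subsingleton
    exact (inferInstance : IsEmpty (PrimeSpectrum
      (blowupAlgebra (Ideal.span (Set.range (centre ι a hX'))) (centre ι a hX' l)))).false q
  haveI : IsDomain (Localization.Away (centre ι a hX' l)) :=
    IsLocalization.isDomain_localization (powers_le_nonZeroDivisors_of_noZeroDivisors hc0)
  exact ⟨hc0, Subalgebra.isDomain _⟩

/-- **The total space is irreducible** when `X` is integral, the base locus is not all of `X` and the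
centre has the local structure `GoodCentre`: `σ⁻¹(X ∖ F) ≅ X ∖ F` is irreducible, and it is dense,
because over the centre the local models are spectra of domains whose generic points lie over the
generic point of `X`. [cite: Hartshorne1977, II Prop. 7.16] -/
theorem irreducibleSpace_total [IsIntegral X.left] (hF : GoodCentre ι a)
    (hV : ((offBase ι a : X.left.Opens) : Set X.left).Nonempty) : IrreducibleSpace (total ι a).left := by
  -- the open `W = σ⁻¹(X ∖ F)` is irreducible
  haveI : Nonempty (offBase ι a) := by
    obtain ⟨x, hx⟩ := hV
    exact ⟨⟨x, hx⟩⟩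
  haveI hiso := isIso_blowDown_restrict_offBase ι a
  haveI : Nonempty ((blowDown ι a).left ⁻¹ᵁ offBase ι a) := by
    obtain ⟨w, -⟩ := (inferInstance : Surjective ((blowDown ι a).left ∣_ offBase ι a)).surj
      (Classical.arbitrary _)
    exact ⟨w⟩
  haveI : IsIntegral ((blowDown ι a).left ⁻¹ᵁ offBase ι a) :=
    isIntegral_of_isOpenImmersion (((blowDown ι a).left ∣_ offBase ι a) ≫ (offBase ι a).ι)
  have hWirr : IsIrreducible (((blowDown ι a).left ⁻¹ᵁ offBase ι a : (total ι a).left.Opens) :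
      Set (total ι a).left) := by
    have h := (IrreducibleSpace.isIrreducible_univ
      (Scheme.Opens.toScheme ((blowDown ι a).left ⁻¹ᵁ offBase ι a))).image
      ((blowDown ι a).left ⁻¹ᵁ offBase ι a).ι.base ((blowDown ι a).left ⁻¹ᵁ offBase ι a).ι.continuous.continuousOn
    rwa [Set.image_univ, Scheme.Opens.range_ι] at h
  -- and dense
  have hgen : genericPoint X.left ∈ offBase ι a :=
    ((genericPoint_spec X.left).mem_open_set_iff (offBase ι a).isOpen).mpr
      (by obtain ⟨x, hx⟩ := hV; exact ⟨x, Set.mem_univ _, hx⟩)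
  have hdense : ∀ z : (total ι a).left,
      z ∈ closure (((blowDown ι a).left ⁻¹ᵁ offBase ι a : (total ι a).left.Opens) : Set (total ι a).left) := by
    intro z
    by_cases hx : (blowDown ι a).left z ∈ baseLocus ι a
    · obtain ⟨h, X', hX', hxX', hq, -⟩ := hF.exists_chart _ hx
      obtain ⟨l, hl⟩ := exists_mem_basicOpen ((proj ι a).left z)
      obtain ⟨e, he⟩ := exists_modelIso ι a h l X' hX' hq
      have hzr : z ∈ Set.range (e.hom ≫ chartSectionToTotal ι a l X') := by
        rw [range_iso_comp_chartSectionToTotal]; exact ⟨hxX', hl⟩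
      obtain ⟨q, rfl⟩ := hzr
      haveI : Nonempty (X' : X.left.Opens) := ⟨⟨_, hxX'⟩⟩
      haveI : IsDomain Γ(X.left, (X' : X.left.Opens)) := IsIntegral.component_integral _
      obtain ⟨hc0, hdom⟩ := isDomain_model_of_nonempty ι a hX' q
      haveI := hdom
      -- the generic point `ξ` of the model specialises to `q` and lies over the generic point of `X`
      set ξ : PrimeSpectrum (blowupAlgebra (Ideal.span (Set.range (centre ι a hX'))) (centre ι a hX' l)) :=
        ⟨⊥, Ideal.isPrime_bot⟩ with hξ
      have hspec : ξ ⤳ q := (PrimeSpectrum.le_iff_specializes ξ q).mp bot_le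
      have hξW : (e.hom ≫ chartSectionToTotal ι a l X') ξ ∈
          (((blowDown ι a).left ⁻¹ᵁ offBase ι a : (total ι a).left.Opens) : Set (total ι a).left) := by
        change (blowDown ι a).left ((e.hom ≫ chartSectionToTotal ι a l X') ξ) ∈ offBase ι a
        rw [← Scheme.Hom.comp_apply, iso_comp_chartSectionToTotal_blowDown ι a hX' e he, Scheme.Hom.comp_apply]
        have hinj : Function.Injective (algebraMap Γ(X.left, (X' : X.left.Opens))
            (blowupAlgebra (Ideal.span (Set.range (centre ι a hX'))) (centre ι a hX' l))) := by
          intro x y hxy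
          exact IsLocalization.injective (Localization.Away (centre ι a hX' l))
            (powers_le_nonZeroDivisors_of_noZeroDivisors hc0) (congrArg Subtype.val hxy)
        have h1 : Spec.map (CommRingCat.ofHom (algebraMap Γ(X.left, (X' : X.left.Opens))
            (blowupAlgebra (Ideal.span (Set.range (centre ι a hX'))) (centre ι a hX' l)))) ξ =
            genericPoint (Spec Γ(X.left, (X' : X.left.Opens))) := by
          rw [genericPoint_eq_bot_of_affine]
          apply PrimeSpectrum.ext
          change Ideal.comap _ ⊥ = ⊥
          rw [← RingHom.ker_eq_comap_bot]
          exact (RingHom.injective_iff_ker_eq_bot _).mp hinj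
        rw [h1, genericPoint_eq_of_isOpenImmersion X'.2.fromSpec]
        exact hgen
      exact closure_mono (Set.singleton_subset_iff.mpr hξW)
        (specializes_iff_mem_closure.mp (hspec.map (e.hom ≫ chartSectionToTotal ι a l X').continuous))
    · exact subset_closure hx
  have huniv : IsIrreducible (Set.univ : Set (total ι a).left) := by
    rw [← Set.eq_univ_of_forall hdense]
    exact hWirr.closure
  exact (irreducibleSpace_def (total ι a).left).mpr huniv

end Global

/-! ### The section of `π` through a rational point of the base locus -/

section Section

open ProjectiveSpace Literature.AlgebraicGeometry.Resolution
open Literature.AlgebraicGeometry.Morphisms.ProjCech (PP)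

variable (a : Fin (m + 1) → Fin (N + 1) → k)

omit [Field k] in
/-- An endomorphism of `Spec k` over `Spec k` is the identity. [folklore] -/
theorem eq_id_of_specOver_self [Field k] (t : specOver k k ⟶ specOver k k) : t = 𝟙 _ := by
  haveI := CurveNet.isIso_specOver_self_hom k
  ext : 1
  have h := Over.w t
  rw [← cancel_mono (specOver k k).hom]
  simpa using h

/-- A point of `X(L)` lies in the base locus `F = X ∩ V(a₀, …, a_m)` iff all the linear forms `aᵢ`
vanish at its homogeneous coordinates. [folklore] -/
theorem pt_mem_baseLocus_iff {L : Type u} [Field L] [Algebra k L] (β : AlgPoints X L)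
    (z : Fin (N + 1) → L) (hz : z ≠ 0) (hβ : AlgPoints.map ι β = pointOfVec k z hz) :
    β.pt ∈ baseLocus ι a ↔ ∀ i, linEval (a i) z = 0 := by
  simp only [baseLocus, LinSec.cutSet, Set.mem_iInter, LinSec.mem_hyp_iff]
  refine forall_congr' fun i => ?_
  have h1 : β.pt ∈ LinSec.XL (ιPP ι) (a i) ↔
      (AlgPoints.map ι β).pt ∈ Proj.basicOpen (MvPolynomial.homogeneousSubmodule (Fin (N + 1)) k)
        (LinSec.linForm (a i)) := Iff.rfl
  rw [h1, hβ, pt_pointOfVec_mem_basicOpen_iff z hz one_pos (LinSec.linForm_mem (a i)),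
    aeval_linForm, not_not]

omit [Field k] in
/-- The incidence forms vanish at `z ⊗ w` as soon as all `aᵢ(z) = 0`. [folklore] -/
theorem forall_aeval_eq_zero_of_forall_linEval_eq_zero [Field k] {L : Type u} [Field L] [Algebra k L]
    (z : Fin (N + 1) → L) (w : Fin (m + 1) → L) (hz : ∀ i, linEval (a i) z = 0) :
    ∀ g ∈ forms a, MvPolynomial.aeval (segreVec z w) g = 0 := by
  rintro _ ⟨p, rfl⟩
  rw [aeval_segreVec_incidenceForm, hz, hz, zero_mul, zero_mul, sub_zero]

/-- `ℙᵐ_k` is integral (an instance on the spelling `(projectiveSpace m k).left`). [folklore] -/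
instance isIntegral_projectiveSpace_left : IsIntegral (projectiveSpace m k).left :=
  isIntegral_projectiveSpace m k

variable (β : AlgPoints X k)

/-- The constant-graph morphism `b ↦ (β, b) : ℙᵐ → X × ℙᵐ` of a rational point `β ∈ X(k)`. [folklore] -/
def graphConst : projectiveSpace m k ⟶ X ⊗ projectiveSpace m k :=
  lift (toSpecOver (projectiveSpace m k) ≫ β) (𝟙 _)

/-- First component of the constant graph: the constant morphism `β`. [folklore] -/
@[reassoc (attr := simp)]
theorem graphConst_fst : graphConst (m := m) β ≫ fst X (projectiveSpace m k) = toSpecOver _ ≫ β :=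
  lift_fst _ _

/-- Second component of the constant graph: the identity. [folklore] -/
@[reassoc (attr := simp)]
theorem graphConst_snd : graphConst (m := m) β ≫ snd X (projectiveSpace m k) = 𝟙 _ := lift_snd _ _

/-- On `k`-points, `graphConst β` is `b ↦ (β, b)`. [folklore] -/
theorem map_graphConst (b : AlgPoints (projectiveSpace m k) k) :
    AlgPoints.map (graphConst β) b = lift β b := by
  rw [AlgPoints.map_apply, graphConst, comp_lift, Category.comp_id, ← Category.assoc,
    eq_id_of_specOver_self (b ≫ toSpecOver _), Category.id_comp]

variable [IsClosedImmersion ι.left] [IsAlgClosed k]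

/-- For `β` in the base locus, every CLOSED point of `ℙᵐ` is sent by `b ↦ (β, b)` into `X̃`. [folklore] -/
theorem graphConst_apply_mem_range_of_isClosed (hβ : β.pt ∈ baseLocus ι a)
    {b₀ : (projectiveSpace m k).left} (hb₀ : IsClosed ({b₀} : Set (projectiveSpace m k).left)) :
    (graphConst β).left b₀ ∈ Set.range (emb ι a).left := by
  -- a `k`-point through the closed point `b₀`
  obtain ⟨τ, hτ⟩ := exists_point_through_closedPoint (projectiveSpace m k).hom k hb₀
  let b : AlgPoints (projectiveSpace m k) k :=
    AlgPoints.mk (Spec.map τ ≫ (projectiveSpace m k).left.fromSpecResidueField b₀) hτ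
  have hbpt : b.pt = b₀ := by
    change ((projectiveSpace m k).left.fromSpecResidueField b₀)
      ((Spec.map τ) (IsLocalRing.closedPoint k)) = b₀
    exact Scheme.fromSpecResidueField_apply _ _
  -- coordinates
  obtain ⟨z, hz, hβz⟩ := exists_eq_pointOfVec (AlgPoints.map ι β)
  obtain ⟨w, hw, hbw⟩ := exists_eq_pointOfVec b
  haveI : IsClosedImmersion (𝟙 (projectiveSpace m k) : projectiveSpace m k ⟶ _).left := by
    rw [Over.id_left]; infer_instance
  have hmem := (Incidence.pt_lift_mem_range_emb_iff ι (𝟙 (projectiveSpace m k))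
    (forms_isHomogeneous a) β z hz hβz b w hw (by rw [AlgPoints.map_id_apply, hbw])).mpr
    (forall_aeval_eq_zero_of_forall_linEval_eq_zero a z w
      ((pt_mem_baseLocus_iff ι a β z hz hβz).mp hβ))
  rw [← map_graphConst, AlgPoints.pt_map, hbpt, ← coe_locus_eq_range, ← range_emb] at hmem
  exact hmem

/-- For `β` in the base locus, `b ↦ (β, b)` maps `ℙᵐ` into `X̃` (set-theoretically): the preimage
of the closed subset `X̃` contains all closed points, which are dense (`ℙᵐ` is Jacobson). [folklore] -/
theorem range_graphConst_subset (hβ : β.pt ∈ baseLocus ι a) :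
    Set.range (graphConst (m := m) β).left ⊆ Set.range (emb ι a).left := by
  have hJ : JacobsonSpace (projectiveSpace m k).left :=
    LocallyOfFiniteType.jacobsonSpace (projectiveSpace m k).hom
  have hcl : IsClosed ((graphConst (m := m) β).left ⁻¹' Set.range (emb ι a).left) :=
    (emb ι a).left.isClosedEmbedding.isClosed_range.preimage (graphConst β).left.continuous
  have hsub : closedPoints (projectiveSpace m k).left ⊆
      (graphConst (m := m) β).left ⁻¹' Set.range (emb ι a).left := fun b₀ hb₀ =>
    graphConst_apply_mem_range_of_isClosed ι a β hβ hb₀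
  have huniv : (graphConst (m := m) β).left ⁻¹' Set.range (emb ι a).left = Set.univ := by
    rw [← Set.univ_subset_iff, ← closure_closedPoints (X := (projectiveSpace m k).left)]
    exact closure_minimal hsub hcl
  rintro _ ⟨b₀, rfl⟩
  have : b₀ ∈ (graphConst (m := m) β).left ⁻¹' Set.range (emb ι a).left := huniv ▸ Set.mem_univ _
  exact this

/-- **The section of `π : X̃ → ℙᵐ` through `β ∈ F(k)`**, `b ↦ (β, b)` (a lift of `graphConst β`
through the closed immersion `X̃ ↪ X × ℙᵐ`, `ℙᵐ` being reduced). [cite: Hartshorne1977, II Example 7.17.3] -/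
def sectionAt (hβ : β.pt ∈ baseLocus ι a) : projectiveSpace m k ⟶ total ι a :=
  Over.homMk (liftOfRangeSubset (emb ι a).left (graphConst β).left (range_graphConst_subset ι a β hβ))
    (by
      have h : (total ι a).hom = (emb ι a).left ≫ (X ⊗ projectiveSpace m k).hom := (Over.w (emb ι a)).symm
      rw [h, liftOfRangeSubset_comp_assoc]
      exact Over.w (graphConst β))

/-- `s_β` followed by `X̃ ↪ X × ℙᵐ` is the constant graph. [folklore] -/
@[reassoc (attr := simp)]
theorem sectionAt_emb (hβ : β.pt ∈ baseLocus ι a) : sectionAt ι a β hβ ≫ emb ι a = graphConst β := by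
  apply Over.OverMorphism.ext
  rw [Over.comp_left]
  exact liftOfRangeSubset_comp (emb ι a).left (graphConst β).left (range_graphConst_subset ι a β hβ)

/-- `s_β` is a section of `π`. [folklore] -/
@[reassoc (attr := simp)]
theorem sectionAt_proj (hβ : β.pt ∈ baseLocus ι a) : sectionAt ι a β hβ ≫ proj ι a = 𝟙 _ := by
  rw [← emb_snd, sectionAt_emb_assoc, graphConst_snd]

/-- `s_β ≫ σ` is the constant morphism `β`. [folklore] -/
theorem sectionAt_blowDown (hβ : β.pt ∈ baseLocus ι a) :
    sectionAt ι a β hβ ≫ blowDown ι a = toSpecOver _ ≫ β := by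
  rw [← emb_fst, sectionAt_emb_assoc, graphConst_fst]

/-- The section on underlying schemes: `s_β ≫ π = 𝟙`. [folklore] -/
theorem sectionAt_left_proj_left (hβ : β.pt ∈ baseLocus ι a) :
    (sectionAt ι a β hβ).left ≫ (proj ι a).left = 𝟙 _ := by
  rw [← Over.comp_left, sectionAt_proj, Over.id_left]

end Section

end LinearSectionNet

end Literature.AlgebraicGeometry.Motives

end
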